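import Mathlib
import Literature.NumberTheory.MahlerMeasure.NonreciprocalBound
import Literature.Analysis.Complex.SchurFunctionTaylorCoefficients
import Literature.NumberTheory.MahlerMeasure.IntegerMahlerMeasure
import HarnessLib

/-!
# Smyth's theorem: a nonreciprocal integer polynomial has Mahler measure `≥ θ₀ = M(z³ − z − 1) = 1.3247…` — `NonreciprocalMahlerBound` HOLDS (re-homed proofs)

**Smyth's theorem** (Smyth 1971; McKee–Smyth, *Around the Unit Circle*, Theorem 12.1): if `P ∈ ℤ[X]` has `P(0) ≠ 0` and is
neither reciprocal nor antireciprocal (`P.reverse ≠ ± P`) then `M(P) ≥ θ₀ = M(z³ − z − 1) = 1.3247…`, the real root of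
`t³ = t + 1` (`intMahlerMeasure_ge_smythTheta_of_nonreciprocal`; no irreducibility hypothesis needed), RE-HOMED into `Literature/`
by the Hodge foundations lane (`lit-hodgefound`, seat p20, generation 36) from the venture cell `pub-namedobj` (seat
`pub-namedobj-mahler`, gens 7–8): verbatim ports, in dependency order and each with its original module docstring (Parts 1–8), of
the modules `Summits/Ventures/DiscreteObjects/Mahler/{BlaschkeData, NonreciprocalMeasureBound (minus its rotation-average lemmas,
which went to the complex-analysis sibling, and its two generic bounds, which went to the base file), SmythArith, SmythAnalytic,
SmythConstant, BlaschkeDataReal, SmythTheorem, MahlerMeasureCompXPow (the sharpness of the bound)}.lean`, namespace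
`Summit.Ventures.DiscreteObjects.Mahler` re-rooted as `Literature.NumberTheory.MahlerMeasure` (this file's path namespace); the
complex-analysis layer (Taylor jets, Schwarz–Pick coefficient bounds, Parseval) is the sibling port
`Literature/Analysis/Complex/SchurFunctionTaylorCoefficients.lean`, and `intMahlerMeasure` with its first properties is the base
file `Literature/NumberTheory/MahlerMeasure/IntegerMahlerMeasure.lean`.

PROOF AS FORMALISED (= [McKee–Smyth §12.2]): reduce to `P` monic with `P(0) = ε = ±1` (else `M ≥ 2`:
`abs_coeff_zero_le_intMahlerMeasure`, `abs_leadingCoeff_le_intMahlerMeasure`); integer side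
`exists_first_nonpalindromic_coeff` / `exists_second_nonpalindromic_coeff` (`εP = P*(1 + aX^k) + bX^ℓ + X^{ℓ+1}R`, `a, b ≠ 0`,
`1 ≤ k < ℓ`); complex side `exists_blaschke_data` / `exists_blaschke_data_symm` (the Blaschke products `f, g` of §12.2.1 with real
coefficients, `f·P* = εP·g` on the disc, `‖f‖, ‖g‖ ≤ 1`, `f(0) = g(0) = 1/M`); the first step (12.6)–(12.10)
`intMahlerMeasure_ge_of_nonreciprocal : M(P) ≥ (1 + √17)/4`; the coefficient relations `smyth_relations`; the analytic inequality
`smyth_analytic` (`c² + c³ ≤ 1` for `c = 1/M`; cases `ℓ < 2k` (§12.2.2, Parseval) / `ℓ ≥ 2k` (§12.2.3, Proposition 12.11 (d)) with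
the arithmetic endgames `smyth_caseA_arith` / `smyth_caseB_arith`); and `SmythConstant` (`θ₀`, `M(z³ − z − 1) = θ₀`,
`t³ ≥ t + 1 ⇒ t ≥ θ₀`); Part 8: the bound is ATTAINED by `x^{3k} − x^k − 1` and `θ₀` is the least such measure
(`isLeast_smythTheta`).  The uniqueness-of-equality and isolation clauses of Theorem 12.1 are NOT in this file.

Definitions kept from the source (with bodies, verbatim): the hypothesis structure `SmythData`, the constant `smythTheta = θ₀`.
No named fact; imports Mathlib/Literature only; every declaration carries the citation of the step of [McKee–Smyth] it
formalises.  Part 9 is the EXACT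
discharge `Literature.NumberTheory.MahlerMeasure.NonreciprocalMahlerBound_holds` of the Literature named fact
`NonreciprocalMahlerBound` (`NonreciprocalBound.lean`, [McKee–Smyth, Theorem 12.1]; its only previous proof was the Summits-side
`Summit.Ventures.DiscreteObjects.Mahler.nonreciprocalMahlerBound_holds`, which `Literature/` cannot import).  The Summits originals
stay in place (transitional duplication).
-/

noncomputable section

/-!
## Part 1 — port of `Summits/Ventures/DiscreteObjects/Mahler/BlaschkeData.lean` (7 declarations kept)

# Blaschke data of a monic integer polynomial (venture `DiscreteObjects`, target L)

Cell `pub-namedobj`, seat `pub-namedobj-mahler` (gen 7). Framing: lottery ticket; floor = certified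
bounds/negative ranges.

Set-up for the nonreciprocal Mahler-measure bound `M(P) ≥ (1+√17)/4` (`NonreciprocalMeasureBound.lean`,
[McKee–Smyth, *Around the Unit Circle*, §12.2.1]):

* `exists_first_nonpalindromic_coeff` — integer side: for `P` monic with `P(0) = ε = ±1` and
  `P.reverse ≠ ε P`, the first nonzero coefficient `a X^k` of `ε P - P.reverse` has `k ≥ 1` and
  `ε P = P.reverse · (1 + a X^k) + X^{k+1} R`;
* `exists_blaschke_data` — complex side: splitting the roots `S` of `P` into `S₁ = {‖α‖ ≤ 1}` and
  `S₂ = {‖α‖ > 1}` (both closed under conjugation, `roots_map_conj`), the Blaschke quotients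
  `f = ε ∏_{S₁} (z-α)/(1-ᾱz)` and `g = ∏_{S₂} (1-ᾱz)/(z-α)` are holomorphic on the unit disc, bounded
  by `1` there (factorwise, `SchwarzPickCoeff`), satisfy `f · P* = ε P · g` (`P* = P.reverse`),
  `‖g 0‖ = 1/M(P)` and `f 0 = g 0`.
-/

section Part1

namespace Literature.NumberTheory.MahlerMeasure

open Literature.Analysis.Complex Literature.Analysis.Complex.SchurAlgorithm

open _root_.Polynomial _root_.Complex _root_.Metric _root_.Set _root_.Filter _root_.Topology
open scoped ComplexConjugate

/-! ### Integer side: the first non-palindromic coefficient -/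

/-- For `P` monic with `P(0) = ε`, `ε² = 1` and `P.reverse ≠ ε P`: the first nonzero coefficient
`a X^k` of `ε P - P.reverse` has `k ≥ 1`, and `ε P = P.reverse · (1 + a X^k) + X^{k+1} R`.
[cite: MckeeSmyth2021, §12.2.1 p.208] -/
theorem exists_first_nonpalindromic_coeff {P : ℤ[X]} (hmonic : P.Monic) {ε : ℤ}
    (hε : P.coeff 0 = ε) (hε1 : ε * ε = 1) (hne : P.reverse ≠ C ε * P) :
    ∃ (k : ℕ) (a : ℤ) (R : ℤ[X]), 1 ≤ k ∧ a ≠ 0 ∧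
      C ε * P = P.reverse * (1 + C a * X ^ k) + X ^ (k + 1) * R := by
  set D : ℤ[X] := C ε * P - P.reverse with hD
  have hD0 : D ≠ 0 := fun h => hne (sub_eq_zero.mp h).symm
  have hDc0 : D.coeff 0 = 0 := by
    rw [hD, coeff_sub, coeff_C_mul, coeff_zero_reverse, hmonic.leadingCoeff, hε, hε1, sub_self]
  set k := D.natTrailingDegree with hk
  set a := D.trailingCoeff with ha
  have ha0 : a ≠ 0 := trailingCoeff_nonzero_iff_nonzero.mpr hD0
  have hk1 : 1 ≤ k := by
    apply le_natTrailingDegree hD0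
    intro m hm
    interval_cases m
    exact hDc0
  have hdvd : X ^ (k + 1) ∣ C ε * P - P.reverse * (1 + C a * X ^ k) := by
    rw [X_pow_dvd_iff]
    intro d hd
    have hrw : C ε * P - P.reverse * (1 + C a * X ^ k) = D - C a * (X ^ k * P.reverse) := by
      rw [hD]; ring
    rw [hrw, coeff_sub, coeff_C_mul, coeff_X_pow_mul']
    rcases Nat.lt_or_ge d k with hlt | hge
    · rw [if_neg (not_le.mpr hlt), coeff_eq_zero_of_lt_natTrailingDegree hlt]; ring
    · have hdk : d = k := by omega
      subst hdk
      rw [if_pos le_rfl, Nat.sub_self, coeff_zero_reverse, hmonic.leadingCoeff, mul_one]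
      change D.coeff D.natTrailingDegree - D.trailingCoeff = 0
      rw [trailingCoeff, sub_self]
  obtain ⟨R, hR⟩ := hdvd
  exact ⟨k, a, R, hk1, ha0, by rw [← hR]; ring⟩

/-! ### Multiset helpers -/

/-- Evaluation of a product of reversed linear factors `1 - c X`. [cite: MckeeSmyth2021, §12.2.1 p.208] -/
theorem eval_multiset_prod_one_sub_C_mul_X (s : Multiset ℂ) (c : ℂ → ℂ) (z : ℂ) :
    ((s.map fun α => (1 : ℂ[X]) - C (c α) * X).prod).eval z = (s.map fun α => 1 - c α * z).prod := by
  rw [eval_multiset_prod, Multiset.map_map]; congr 1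
  apply Multiset.map_congr rfl; intro α _; simp

/-- The reverse of a product of monic linear factors: `(∏ (X - α))* = ∏ (1 - α X)`.
[cite: MckeeSmyth2021, §12.2.1 p.208] -/
theorem reverse_multiset_prod_X_sub_C (s : Multiset ℂ) :
    ((s.map fun α => X - C α).prod).reverse = (s.map fun α => (1 : ℂ[X]) - C α * X).prod := by
  have h1 : (1 : ℂ[X]).reverse = 1 := by simpa using reverse_C (1 : ℂ)
  have hX : (X : ℂ[X]).reverse = 1 := by simpa [h1] using reverse_mul_X (1 : ℂ[X])
  induction s using Multiset.induction_on with
  | empty => simpa using h1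
  | cons b t ih =>
    rw [Multiset.map_cons, Multiset.prod_cons, Multiset.map_cons, Multiset.prod_cons,
      reverse_mul_of_domain, ih]
    congr 1
    rw [sub_eq_add_neg, ← C_neg, reverse_add_C, natDegree_X, pow_one, hX, C_neg]; ring

/-! ### Complex side: roots and Blaschke products -/

/-- The complex roots of an integer polynomial form a multiset closed under conjugation.
[cite: MckeeSmyth2021, §12.2.1 p.208] -/
theorem roots_map_conj (P : ℤ[X]) :
    ((P.map (Int.castRingHom ℂ)).roots).map (starRingEnd ℂ) = (P.map (Int.castRingHom ℂ)).roots := by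
  set Pc := P.map (Int.castRingHom ℂ) with hPc
  have h1 : Pc.map (starRingEnd ℂ) = Pc := by
    rw [hPc, Polynomial.map_map, RingHom.ext_int ((starRingEnd ℂ).comp (Int.castRingHom ℂ))
      (Int.castRingHom ℂ)]
  have h2 := roots_map_of_injective_of_card_eq_natDegree (p := Pc) (starRingEnd ℂ).injective
    IsAlgClosed.card_roots_eq_natDegree
  rwa [h1] at h2

/-- Reverse commutes with the embedding `ℤ[X] → ℂ[X]`. [cite: MckeeSmyth2021, §12.2.1 p.208] -/
theorem reverse_map_intCast (P : ℤ[X]) :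
    (P.map (Int.castRingHom ℂ)).reverse = P.reverse.map (Int.castRingHom ℂ) := by
  unfold reverse
  rw [reflect_map, natDegree_map_eq_of_injective (RingHom.injective_int _)]

/-- A filtered sub-multiset of the roots by a conjugation-invariant predicate is conjugation-closed.
[cite: MckeeSmyth2021, §12.2.1 p.208] -/
theorem filter_roots_map_conj (P : ℤ[X]) (q : ℂ → Prop) [DecidablePred q]
    (hq : ∀ α, q (starRingEnd ℂ α) ↔ q α) :
    (((P.map (Int.castRingHom ℂ)).roots).filter q).map (starRingEnd ℂ) =
      ((P.map (Int.castRingHom ℂ)).roots).filter q := by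
  conv_rhs => rw [← roots_map_conj P]
  rw [Multiset.filter_map]
  congr 1
  apply Multiset.filter_congr
  intro α _
  exact (hq α).symm

/-- **Blaschke data of a monic integer polynomial with `P(0) = ε = ±1`.**  There are functions `f, g`
holomorphic on the unit disc, bounded by `1` there, with `f · P* = ε · P · g` on the disc
(`P* = P.reverse`), `‖g 0‖ = 1/M(P)` and `f 0 = g 0`.  (`f = ε ∏_{‖α‖≤1} (z-α)/(1-ᾱz)`,
`g = ∏_{‖α‖>1} (1-ᾱz)/(z-α)` over the complex roots `α` of `P`.) [cite: MckeeSmyth2021, §12.2.1 p.208] -/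
theorem exists_blaschke_data {P : ℤ[X]} (hmonic : P.Monic) {ε : ℤ} (hε : P.coeff 0 = ε)
    (hε1 : ε * ε = 1) :
    ∃ f g : ℂ → ℂ, DifferentiableOn ℂ f (ball 0 1) ∧ DifferentiableOn ℂ g (ball 0 1) ∧
      (∀ z ∈ ball (0 : ℂ) 1, ‖f z‖ ≤ 1) ∧ (∀ z ∈ ball (0 : ℂ) 1, ‖g z‖ ≤ 1) ∧
      (∀ z ∈ ball (0 : ℂ) 1, f z * (P.reverse.map (Int.castRingHom ℂ)).eval z =
        (ε : ℂ) * (P.map (Int.castRingHom ℂ)).eval z * g z) ∧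
      ‖g 0‖ = (intMahlerMeasure P)⁻¹ ∧ f 0 = g 0 := by
  classical
  set Pc := P.map (Int.castRingHom ℂ) with hPc
  have hPcm : Pc.Monic := hmonic.map _
  set S := Pc.roots with hSdef
  have hcard : Multiset.card S = Pc.natDegree := IsAlgClosed.card_roots_eq_natDegree
  have hprod : (S.map fun α => X - C α).prod = Pc :=
    prod_multiset_X_sub_C_of_monic_of_roots_card_eq hPcm hcard
  set S₁ := S.filter fun α => ‖α‖ ≤ 1 with hS₁
  set S₂ := S.filter fun α => ¬ ‖α‖ ≤ 1 with hS₂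
  have hS : S₁ + S₂ = S := Multiset.filter_add_not _ S
  have hS₁conj : S₁.map (starRingEnd ℂ) = S₁ :=
    filter_roots_map_conj P _ (fun α => by rw [Complex.norm_conj])
  have hS₂conj : S₂.map (starRingEnd ℂ) = S₂ :=
    filter_roots_map_conj P _ (fun α => by rw [Complex.norm_conj])
  have hmem₁ : ∀ α ∈ S₁, ‖α‖ ≤ 1 := fun α hα => (Multiset.mem_filter.mp hα).2
  have hmem₂ : ∀ α ∈ S₂, 1 ≤ ‖α‖ := fun α hα => (not_le.mp (Multiset.mem_filter.mp hα).2).le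
  have hmem₂' : ∀ α ∈ S₂, 1 < ‖α‖ := fun α hα => not_le.mp (Multiset.mem_filter.mp hα).2
  -- the four polynomials
  set A : ℂ[X] := (S₁.map fun α => X - C α).prod with hA
  set B : ℂ[X] := (S₂.map fun α => X - C α).prod with hB
  set Abar : ℂ[X] := (S₁.map fun α => (1 : ℂ[X]) - C (starRingEnd ℂ α) * X).prod with hAbar
  set Bbar : ℂ[X] := (S₂.map fun α => (1 : ℂ[X]) - C (starRingEnd ℂ α) * X).prod with hBbar
  have hPAB : Pc = A * B := by
    rw [← hprod, ← hS, Multiset.map_add, Multiset.prod_add]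
  have hconj_prod : ∀ T : Multiset ℂ, T.map (starRingEnd ℂ) = T →
      (T.map fun α => (1 : ℂ[X]) - C (starRingEnd ℂ α) * X).prod =
        (T.map fun α => (1 : ℂ[X]) - C α * X).prod := by
    intro T hT
    conv_rhs => rw [← hT, Multiset.map_map]
    rfl
  have hPrev : Pc.reverse = Abar * Bbar := by
    rw [← hprod, reverse_multiset_prod_X_sub_C, ← hS, Multiset.map_add, Multiset.prod_add,
      ← hconj_prod S₁ hS₁conj, ← hconj_prod S₂ hS₂conj]
  have hPrev' : P.reverse.map (Int.castRingHom ℂ) = Abar * Bbar := by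
    rw [← reverse_map_intCast, ← hPc, hPrev]
  -- evaluations
  have hAe : ∀ z, A.eval z = (S₁.map fun α => z - α).prod := fun z => eval_multiset_prod_X_sub_C S₁ z
  have hBe : ∀ z, B.eval z = (S₂.map fun α => z - α).prod := fun z => eval_multiset_prod_X_sub_C S₂ z
  have hAbe : ∀ z, Abar.eval z = (S₁.map fun α => 1 - starRingEnd ℂ α * z).prod := fun z =>
    eval_multiset_prod_one_sub_C_mul_X S₁ _ z
  have hBbe : ∀ z, Bbar.eval z = (S₂.map fun α => 1 - starRingEnd ℂ α * z).prod := fun z =>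
    eval_multiset_prod_one_sub_C_mul_X S₂ _ z
  -- nonvanishing on the disc
  have hAbar0 : ∀ z ∈ ball (0 : ℂ) 1, Abar.eval z ≠ 0 := by
    intro z hz
    rw [hAbe]
    apply multiset_prod_ne_zero
    intro α hα h0
    have h1 : starRingEnd ℂ α * z = 1 := (sub_eq_zero.mp h0).symm
    have h2 : ‖starRingEnd ℂ α * z‖ < 1 := by
      rw [norm_mul, Complex.norm_conj]
      have := hmem₁ α hα
      have hz' := mem_ball_zero_iff.mp hz
      calc ‖α‖ * ‖z‖ ≤ 1 * ‖z‖ := by gcongr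
        _ < 1 := by rw [one_mul]; exact hz'
    rw [h1, norm_one] at h2
    exact lt_irrefl _ h2
  have hB0 : ∀ z ∈ ball (0 : ℂ) 1, B.eval z ≠ 0 := by
    intro z hz
    rw [hBe]
    apply multiset_prod_ne_zero
    intro α hα h0
    have h1 : z = α := sub_eq_zero.mp h0
    have := hmem₂' α hα
    rw [← h1] at this
    exact absurd (mem_ball_zero_iff.mp hz) (not_lt.mpr this.le)
  -- the functions
  refine ⟨fun z => (ε : ℂ) * A.eval z / Abar.eval z, fun z => Bbar.eval z / B.eval z,
    ?_, ?_, ?_, ?_, ?_, ?_, ?_⟩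
  · -- differentiability of f
    apply DifferentiableOn.div _ _ hAbar0
    · exact ((Polynomial.differentiable A).const_mul _).differentiableOn
    · exact (Polynomial.differentiable Abar).differentiableOn
  · apply DifferentiableOn.div _ _ hB0
    · exact (Polynomial.differentiable Bbar).differentiableOn
    · exact (Polynomial.differentiable B).differentiableOn
  · -- bound for f
    intro z hz
    have hz' : ‖z‖ ≤ 1 := (mem_ball_zero_iff.mp hz).le
    have hεn : ‖(ε : ℂ)‖ = 1 := by
      have : ((ε : ℂ)) * (ε : ℂ) = 1 := by exact_mod_cast hε1
      have h := congrArg norm this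
      rw [norm_mul, norm_one] at h
      nlinarith [norm_nonneg (ε : ℂ)]
    rw [norm_div, norm_mul, hεn, one_mul]
    apply div_le_one_of_le₀ _ (norm_nonneg _)
    rw [hAe, hAbe]
    exact norm_multiset_prod_le fun α hα => norm_sub_le_norm_one_sub_conj_mul (hmem₁ α hα) hz'
  · -- bound for g
    intro z hz
    have hz' : ‖z‖ ≤ 1 := (mem_ball_zero_iff.mp hz).le
    rw [norm_div]
    apply div_le_one_of_le₀ _ (norm_nonneg _)
    rw [hBe, hBbe]
    exact norm_multiset_prod_le fun α hα => norm_one_sub_conj_mul_le_norm_sub (hmem₂ α hα) hz'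
  · -- the identity f · P* = ε P g
    intro z hz
    simp only
    rw [hPrev', hPAB, eval_mul, eval_mul]
    field_simp [hAbar0 z hz, hB0 z hz]
  · -- ‖g 0‖ = 1/M
    have hB0e : ‖B.eval 0‖ = (S₂.map fun α => ‖α‖).prod := by
      rw [hBe, norm_multiset_prod_eq]
      congr 1
      apply Multiset.map_congr rfl
      intro α _; simp
    have hBb0e : Bbar.eval 0 = 1 := by
      rw [hBbe]; simp
    have hM : intMahlerMeasure P = (S₂.map fun α => ‖α‖).prod := by
      unfold intMahlerMeasure
      rw [← hPc, mahlerMeasure_eq_leadingCoeff_mul_prod_roots, hPcm.leadingCoeff, norm_one, one_mul,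
        ← hSdef, ← hS, Multiset.map_add, Multiset.prod_add]
      have h1 : (S₁.map fun α => max 1 ‖α‖).prod = 1 := by
        apply Multiset.prod_eq_one
        intro x hx
        obtain ⟨α, hα, rfl⟩ := Multiset.mem_map.mp hx
        exact max_eq_left (hmem₁ α hα)
      have h2 : (S₂.map fun α => max 1 ‖α‖) = S₂.map fun α => ‖α‖ := by
        apply Multiset.map_congr rfl
        intro α hα
        exact max_eq_right (hmem₂ α hα)
      rw [h1, h2, one_mul]
    simp only
    rw [norm_div, hBb0e, norm_one, hB0e, hM, one_div]
  · -- f 0 = g 0, from the identity at 0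
    have hPc0 : Pc.eval 0 = (ε : ℂ) := by
      rw [← coeff_zero_eq_eval_zero, hPc, coeff_map, hε]; simp
    have hPr0 : (P.reverse.map (Int.castRingHom ℂ)).eval 0 = 1 := by
      rw [← coeff_zero_eq_eval_zero, coeff_map, coeff_zero_reverse, hmonic.leadingCoeff]; simp
    have hεε : ((ε : ℂ)) * (ε : ℂ) = 1 := by exact_mod_cast hε1
    have hAbar00 : Abar.eval 0 ≠ 0 := hAbar0 0 (mem_ball_self one_pos)
    have hB00 : B.eval 0 ≠ 0 := hB0 0 (mem_ball_self one_pos)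
    have hid : (ε : ℂ) * A.eval 0 / Abar.eval 0 * (P.reverse.map (Int.castRingHom ℂ)).eval 0 =
        (ε : ℂ) * Pc.eval 0 * (Bbar.eval 0 / B.eval 0) := by
      rw [hPrev', hPAB, eval_mul, eval_mul]
      field_simp
    rw [hPr0, mul_one, hPc0] at hid
    simp only
    rw [hid, hεε, one_mul]

end Literature.NumberTheory.MahlerMeasure

end Part1

/-!
## Part 2 — port of `Summits/Ventures/DiscreteObjects/Mahler/NonreciprocalMeasureBound.lean` (4 declarations kept)

# Nonreciprocal integer polynomials have Mahler measure `≥ (1 + √17)/4` (venture `DiscreteObjects`, target L)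

Cell `pub-namedobj`, seat `pub-namedobj-mahler` (gen 7). Framing: lottery ticket; floor = certified
bounds/negative ranges.

We PROVE the classical first step of Smyth's 1971 argument ([McKee–Smyth, *Around the Unit Circle*,
§12.2.1, (12.6)–(12.10) p.209]): if `P ∈ ℤ[X]` has `P(0) ≠ 0` and is not (anti)reciprocal
(`P.reverse ≠ ± P`), then `M(P) ≥ (1 + √17)/4 = 1.2807…` (`intMahlerMeasure_ge_of_nonreciprocal`).
In particular `M(P) > 1.28 > M(L) = 1.17628…` (Lehmer's polynomial), so NO nonreciprocal integer
polynomial is sub-Lehmer — unconditionally, without Smyth's full theorem `M(P) ≥ θ₀ = 1.3247…` (the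
named fact `Literature.NumberTheory.MahlerMeasure.NonreciprocalMahlerBound`, typed but not proved in
the tree).  This removes the Smyth hypothesis from the census kernel (`NonreciprocalStructure.lean`).

Proof (Hardy-function method).  Reduce to `P` monic with `P(0) = ε = ±1` (else `M ≥ 2`).  With the
Blaschke data `f, g` of `BlaschkeData.lean` (`f · P* = ε P · g` on the disc, `‖f‖, ‖g‖ ≤ 1`,
`‖g 0‖ = 1/M`, `f 0 = g 0 = c`) and the integer identity `ε P = P* (1 + a X^k) + X^{k+1} R` (`k ≥ 1`,
`a ≠ 0`), average over the `k`-th roots of unity: the averages `Φ_f, Φ_g` are rotation invariant, hence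
`Φ_f = c + z^k ψ_f`, `Φ_g = c + z^k ψ_g` (`SchwarzPickCoeff.exists_flat_of_rotation_invariant`), with
`ψ_f(0) = ψ_g(0) + a c` (comparison near `0`, where `P* ≠ 0`).  The Schwarz–Pick coefficient bound
gives `‖ψ_f(0)‖, ‖ψ_g(0)‖ ≤ 1 - ‖c‖²`; hence `|a|/M ≤ 2(1 - 1/M²)`, i.e. `2M² - M - 2 ≥ 0`.
-/

section Part2

namespace Literature.NumberTheory.MahlerMeasure

open Literature.Analysis.Complex Literature.Analysis.Complex.SchurAlgorithm

open _root_.Polynomial _root_.Complex _root_.Metric _root_.Set _root_.Filter _root_.Topology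
open scoped ComplexConjugate

/-! ### Averaging over the `k`-th roots of unity -/

/-- **Key inequality.**  If `P` is monic with `P(0) = ε = ±1` and `ε P = P* (1 + a X^k) + X^{k+1} R`
with `k ≥ 1`, then `|a| / M(P) ≤ 2 (1 - 1/M(P)²)`. [cite: MckeeSmyth2021, §12.2.1 (12.6)–(12.10) p.209] -/
theorem abs_mul_inv_measure_le {P : ℤ[X]} (hmonic : P.Monic) {ε : ℤ} (hε : P.coeff 0 = ε)
    (hε1 : ε * ε = 1) {k : ℕ} {a : ℤ} {R : ℤ[X]} (hk : 1 ≤ k)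
    (hid : C ε * P = P.reverse * (1 + C a * X ^ k) + X ^ (k + 1) * R) :
    |(a : ℝ)| * (intMahlerMeasure P)⁻¹ ≤ 2 * (1 - (intMahlerMeasure P)⁻¹ ^ 2) := by
  obtain ⟨f, g, hfd, hgd, hfb, hgb, hfg, hg0, hf0⟩ := exists_blaschke_data hmonic hε hε1
  have hball : ball (0 : ℂ) 1 ∈ 𝓝 (0 : ℂ) := ball_mem_nhds _ one_pos
  set Pc := P.map (Int.castRingHom ℂ) with hPc
  set Prc := P.reverse.map (Int.castRingHom ℂ) with hPrc
  set Rc := R.map (Int.castRingHom ℂ) with hRc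
  -- complex form of the integer identity
  have hidC : ∀ w : ℂ, (ε : ℂ) * Pc.eval w =
      Prc.eval w * (1 + (a : ℂ) * w ^ k) + w ^ (k + 1) * Rc.eval w := by
    intro w
    have h := congrArg (fun Q : ℤ[X] => (Q.map (Int.castRingHom ℂ)).eval w) hid
    simpa [Polynomial.map_mul, Polynomial.map_add, Polynomial.map_pow, eval_mul, eval_add,
      eval_pow] using h
  -- a disc `ball 0 r` on which `P*` does not vanish
  have hPrc0 : Prc.eval 0 = 1 := by
    rw [← coeff_zero_eq_eval_zero, hPrc, coeff_map, coeff_zero_reverse, hmonic.leadingCoeff]; simp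
  obtain ⟨r, hr0, hr1, hPr⟩ : ∃ r : ℝ, 0 < r ∧ r ≤ 1 ∧ ∀ w ∈ ball (0 : ℂ) r, Prc.eval w ≠ 0 := by
    have hc : ContinuousAt (fun w => Prc.eval w) 0 := (Polynomial.continuous Prc).continuousAt
    have hne : ∀ᶠ w in 𝓝 (0 : ℂ), Prc.eval w ≠ 0 := by
      apply hc.eventually_ne; rw [hPrc0]; exact one_ne_zero
    obtain ⟨r, hr0, hr⟩ := Metric.eventually_nhds_iff_ball.mp hne
    exact ⟨min r 1, lt_min hr0 one_pos, min_le_right _ _,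
      fun w hw => hr w (ball_subset_ball (min_le_left _ _) hw)⟩
  have hsub : ball (0 : ℂ) r ⊆ ball 0 1 := ball_subset_ball hr1
  have hballr : ball (0 : ℂ) r ∈ 𝓝 (0 : ℂ) := ball_mem_nhds _ hr0
  -- the error term `E = R g / P*` and the pointwise identity `f = (1 + a w^k) g + w^{k+1} E`
  set E : ℂ → ℂ := fun w => Rc.eval w * g w / Prc.eval w with hE
  have hEc : ContinuousOn E (ball 0 r) := by
    apply ContinuousOn.div
    · exact (Polynomial.continuous Rc).continuousOn.mul (hgd.continuousOn.mono hsub)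
    · exact (Polynomial.continuous Prc).continuousOn
    · exact hPr
  have hpt : ∀ w ∈ ball (0 : ℂ) r, f w = (1 + (a : ℂ) * w ^ k) * g w + w ^ (k + 1) * E w := by
    intro w hw
    have h1 := hfg w (hsub hw)
    have h2 := hidC w
    have h3 := hPr w hw
    simp only [hE]
    field_simp
    linear_combination h1 + g w * h2
  -- roots of unity
  set ω : ℂ := Complex.exp (2 * Real.pi * Complex.I / k) with hωdef
  have hω : IsPrimitiveRoot ω k := Complex.isPrimitiveRoot_exp k (by omega)
  have hω1 : ‖ω‖ = 1 := hω.norm'_eq_one (by omega)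
  have hωk : ω ^ k = 1 := hω.pow_eq_one
  -- the averaged functions and their flat decompositions
  set Φf : ℂ → ℂ := fun z => (k : ℂ)⁻¹ * ∑ j ∈ Finset.range k, f (ω ^ j * z) with hΦf_def
  set Φg : ℂ → ℂ := fun z => (k : ℂ)⁻¹ * ∑ j ∈ Finset.range k, g (ω ^ j * z) with hΦg_def
  have hΦfd : DifferentiableOn ℂ Φf (ball 0 1) := differentiableOn_rotAvg k hω1 hfd
  have hΦgd : DifferentiableOn ℂ Φg (ball 0 1) := differentiableOn_rotAvg k hω1 hgd
  obtain ⟨ψf, hψfd, hψf⟩ := exists_flat_of_rotation_invariant hω hk hΦfd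
    (fun z _ => rotAvg_rot k hωk f z)
  obtain ⟨ψg, hψgd, hψg⟩ := exists_flat_of_rotation_invariant hω hk hΦgd
    (fun z _ => rotAvg_rot k hωk g z)
  set c : ℂ := g 0 with hc
  have hΦf0 : Φf 0 = c := by rw [hΦf_def]; simp only; rw [rotAvg_zero hk, hf0]
  have hΦg0 : Φg 0 = c := by rw [hΦg_def]; simp only; exact rotAvg_zero hk ω g
  -- Schwarz–Pick bounds
  have hbf : ‖ψf 0‖ ≤ 1 - ‖c‖ ^ 2 :=
    norm_coeff_le_one_sub_norm_sq hk hψfd (fun z hz => norm_rotAvg_le_one hk hω1 hfb hz)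
      (fun z hz => by rw [← hΦf0]; exact hψf z hz)
  have hbg : ‖ψg 0‖ ≤ 1 - ‖c‖ ^ 2 :=
    norm_coeff_le_one_sub_norm_sq hk hψgd (fun z hz => norm_rotAvg_le_one hk hω1 hgb hz)
      (fun z hz => by rw [← hΦg0]; exact hψg z hz)
  -- the coefficient relation `ψf 0 = ψg 0 + a c`
  set H : ℂ → ℂ := fun z => (k : ℂ)⁻¹ * ∑ j ∈ Finset.range k, ω ^ (j * (k + 1)) * E (ω ^ j * z)
    with hH
  have hHc : ContinuousOn H (ball 0 r) := by
    show ContinuousOn (fun z => (k : ℂ)⁻¹ *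
      ∑ j ∈ Finset.range k, ω ^ (j * (k + 1)) * E (ω ^ j * z)) (ball 0 r)
    apply ContinuousOn.mul continuousOn_const
    apply continuousOn_finsetSum
    intro j _
    apply ContinuousOn.mul continuousOn_const
    exact hEc.comp (continuousOn_const.mul continuousOn_id) fun z hz => pow_mul_mem_ball hω1 j hz
  have havg : ∀ z ∈ ball (0 : ℂ) r,
      Φf z = (1 + (a : ℂ) * z ^ k) * Φg z + z ^ (k + 1) * H z := by
    intro z hz
    have hsum : ∑ j ∈ Finset.range k, f (ω ^ j * z) = ∑ j ∈ Finset.range k,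
        ((1 + (a : ℂ) * z ^ k) * g (ω ^ j * z) + z ^ (k + 1) * (ω ^ (j * (k + 1)) * E (ω ^ j * z))) := by
      apply Finset.sum_congr rfl
      intro j _
      rw [hpt _ (pow_mul_mem_ball hω1 j hz)]
      have hωjk : (ω ^ j) ^ k = 1 := by rw [← pow_mul, mul_comm, pow_mul, hωk, one_pow]
      have e1 : (ω ^ j * z) ^ k = z ^ k := by rw [mul_pow, hωjk, one_mul]
      have e2 : (ω ^ j * z) ^ (k + 1) = ω ^ (j * (k + 1)) * z ^ (k + 1) := by
        rw [mul_pow, ← pow_mul]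
      rw [e1, e2]
      ring
    show (k : ℂ)⁻¹ * ∑ j ∈ Finset.range k, f (ω ^ j * z) =
      (1 + (a : ℂ) * z ^ k) * ((k : ℂ)⁻¹ * ∑ j ∈ Finset.range k, g (ω ^ j * z)) +
        z ^ (k + 1) * ((k : ℂ)⁻¹ * ∑ j ∈ Finset.range k, ω ^ (j * (k + 1)) * E (ω ^ j * z))
    rw [hsum, Finset.sum_add_distrib, ← Finset.mul_sum, ← Finset.mul_sum]
    ring
  have hrel : ψf 0 = ψg 0 + (a : ℂ) * c := by
    set G : ℂ → ℂ := fun z => ψf z - ψg z - (a : ℂ) * c - ((a : ℂ) * z ^ k * ψg z + z * H z)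
      with hG
    have hGc : ContinuousAt G 0 := by
      have h1 : ContinuousAt ψf 0 := (hψfd.differentiableAt hball).continuousAt
      have h2 : ContinuousAt ψg 0 := (hψgd.differentiableAt hball).continuousAt
      have h3 : ContinuousAt H 0 := hHc.continuousAt hballr
      simp only [hG]
      fun_prop
    have hGoff : G =ᶠ[𝓝[≠] (0 : ℂ)] fun _ => 0 := by
      have hmem : {(0 : ℂ)}ᶜ ∩ ball (0 : ℂ) r ∈ 𝓝[≠] (0 : ℂ) := inter_mem_nhdsWithin _ hballr
      filter_upwards [hmem] with z hz
      obtain ⟨hz0, hzr⟩ := hz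
      have hz0' : z ≠ 0 := hz0
      have h := havg z hzr
      rw [hψf z (hsub hzr), hψg z (hsub hzr), hΦf0, hΦg0] at h
      have hzk : z ^ k ≠ 0 := pow_ne_zero k hz0'
      have h' : z ^ k * (ψf z - ψg z - (a : ℂ) * c - ((a : ℂ) * z ^ k * ψg z + z * H z)) = 0 := by
        linear_combination h
      exact (mul_eq_zero.mp h').resolve_left hzk
    have hG0 : G 0 = 0 := by
      have h1 : Tendsto G (𝓝[≠] (0 : ℂ)) (𝓝 (G 0)) := hGc.tendsto.mono_left nhdsWithin_le_nhds
      have h2 : Tendsto G (𝓝[≠] (0 : ℂ)) (𝓝 0) := tendsto_const_nhds.congr' hGoff.symm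
      exact tendsto_nhds_unique h1 h2
    simp only [hG, zero_pow (by omega : k ≠ 0), mul_zero, zero_mul, add_zero, sub_zero] at hG0
    linear_combination hG0
  -- conclusion
  have hac : ‖(a : ℂ) * c‖ ≤ 2 * (1 - ‖c‖ ^ 2) := by
    have : (a : ℂ) * c = ψf 0 - ψg 0 := by rw [hrel]; ring
    rw [this]
    calc ‖ψf 0 - ψg 0‖ ≤ ‖ψf 0‖ + ‖ψg 0‖ := norm_sub_le _ _
      _ ≤ (1 - ‖c‖ ^ 2) + (1 - ‖c‖ ^ 2) := add_le_add hbf hbg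
      _ = 2 * (1 - ‖c‖ ^ 2) := by ring
  rw [norm_mul, Complex.norm_intCast, hg0] at hac
  exact_mod_cast hac

/-! ### Elementary lower bounds `M(P) ≥ |lc P|`, `M(P) ≥ |P(0)|` -/

/-- The algebra of the conclusion: from `x ≤ 2 (1 - x²)` with `x = 1/M > 0` one gets
`M ≥ (1 + √17)/4`. [cite: MckeeSmyth2021, §12.2.1 (12.6)–(12.10) p.209] -/
theorem bound_of_quadratic {M : ℝ} (hM : 0 < M) (h : M⁻¹ ≤ 2 * (1 - M⁻¹ ^ 2)) :
    (1 + Real.sqrt 17) / 4 ≤ M := by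
  set x := M⁻¹ with hx
  have hx0 : 0 < x := inv_pos.mpr hM
  set s := Real.sqrt 17 with hs
  have hs2 : s ^ 2 = 17 := Real.sq_sqrt (by norm_num)
  have hs0 : 0 ≤ s := Real.sqrt_nonneg 17
  set ρ := (s - 1) / 4 with hρ
  have hρeq : 2 * ρ ^ 2 + ρ - 2 = 0 := by rw [hρ]; nlinarith [hs2]
  have hρ0 : 0 < ρ := by
    rw [hρ]
    have : 1 < s := by nlinarith [hs2, hs0]
    linarith
  have hxρ : x ≤ ρ := by
    by_contra hlt
    push Not at hlt
    have h1 : 0 < (x - ρ) * (2 * (x + ρ) + 1) := mul_pos (by linarith) (by linarith)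
    have h2 : (x - ρ) * (2 * (x + ρ) + 1) = (2 * x ^ 2 + x - 2) - (2 * ρ ^ 2 + ρ - 2) := by ring
    rw [h2, hρeq, sub_zero] at h1
    linarith
  have hρinv : ρ⁻¹ = (1 + s) / 4 := by
    have : ρ * ((1 + s) / 4) = 1 := by rw [hρ]; nlinarith [hs2]
    exact (eq_inv_of_mul_eq_one_right this).symm
  calc (1 + s) / 4 = ρ⁻¹ := hρinv.symm
    _ ≤ x⁻¹ := inv_anti₀ hx0 hxρ
    _ = M := by rw [hx, inv_inv]

/-- **Nonreciprocal integer polynomials have Mahler measure `≥ (1+√17)/4 = 1.2807…`**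
([McKee–Smyth, *Around the Unit Circle*, (12.10)]; the first step of Smyth's 1971 proof that in fact
`M ≥ θ₀ = 1.3247…`).  Hypotheses: `P(0) ≠ 0` and `P` is neither reciprocal nor antireciprocal.
[cite: MckeeSmyth2021, §12.2.1 (12.6)–(12.10) p.209] -/
theorem intMahlerMeasure_ge_of_nonreciprocal {P : ℤ[X]} (h0 : P.coeff 0 ≠ 0) (h1 : P.reverse ≠ P)
    (h2 : P.reverse ≠ -P) : (1 + Real.sqrt 17) / 4 ≤ intMahlerMeasure P := by
  have hP0 : P ≠ 0 := fun h => h0 (by simp [h])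
  have hs2 : Real.sqrt 17 ^ 2 = 17 := Real.sq_sqrt (by norm_num)
  have hs0 : 0 ≤ Real.sqrt 17 := Real.sqrt_nonneg 17
  have hbound2 : (1 + Real.sqrt 17) / 4 ≤ 2 := by nlinarith [hs2, hs0]
  -- leading coefficient `± 1`, else `M ≥ 2`
  by_cases hlc : 2 ≤ |P.leadingCoeff|
  · have h := abs_leadingCoeff_le_intMahlerMeasure P
    have : (2 : ℝ) ≤ |(P.leadingCoeff : ℝ)| := by exact_mod_cast hlc
    linarith
  have hlc1 : |P.leadingCoeff| = 1 := by
    have hne : P.leadingCoeff ≠ 0 := leadingCoeff_ne_zero.mpr hP0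
    have := Int.one_le_abs hne
    omega
  -- reduce to the monic case via `P ↦ -P`
  obtain ⟨Q, hQm, hQM, hQ0, hQ1, hQ2⟩ : ∃ Q : ℤ[X], Q.Monic ∧ intMahlerMeasure Q = intMahlerMeasure P ∧
      Q.coeff 0 ≠ 0 ∧ Q.reverse ≠ Q ∧ Q.reverse ≠ -Q := by
    rcases (abs_eq (zero_le_one' ℤ)).mp hlc1 with h | h
    · exact ⟨P, h, rfl, h0, h1, h2⟩
    · refine ⟨-P, ?_, intMahlerMeasure_neg P, by simpa using h0, ?_, ?_⟩
      · rw [Monic, leadingCoeff_neg, h, neg_neg]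
      · rw [reverse_neg]; intro h'; exact h1 (neg_injective h')
      · rw [reverse_neg, neg_neg]; intro h'; exact h2 (by rw [← neg_neg P.reverse, h'])
  rw [← hQM]
  -- constant coefficient `± 1`, else `M ≥ 2`
  by_cases hc : 2 ≤ |Q.coeff 0|
  · have h := abs_coeff_zero_le_intMahlerMeasure hQm
    have : (2 : ℝ) ≤ |(Q.coeff 0 : ℝ)| := by exact_mod_cast hc
    linarith
  have hc1 : |Q.coeff 0| = 1 := by
    have := Int.one_le_abs hQ0
    omega
  set ε := Q.coeff 0 with hεdef
  have hε1 : ε * ε = 1 := by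
    rcases (abs_eq (zero_le_one' ℤ)).mp hc1 with h | h <;> simp [h]
  have hne : Q.reverse ≠ C ε * Q := by
    rcases (abs_eq (zero_le_one' ℤ)).mp hc1 with h | h
    · rw [h, C_1, one_mul]; exact hQ1
    · rw [h, C_neg, C_1, neg_one_mul]; exact hQ2
  obtain ⟨k, a, R, hk, ha, hid⟩ := exists_first_nonpalindromic_coeff hQm rfl hε1 hne
  have key := abs_mul_inv_measure_le hQm rfl hε1 hk hid
  have hM1 : 1 ≤ intMahlerMeasure Q := by
    have h := abs_leadingCoeff_le_intMahlerMeasure Q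
    rw [hQm.leadingCoeff] at h; simpa using h
  have hMpos : 0 < intMahlerMeasure Q := lt_of_lt_of_le one_pos hM1
  have ha1 : (1 : ℝ) ≤ |(a : ℝ)| := by exact_mod_cast Int.one_le_abs ha
  have hx0 : 0 < (intMahlerMeasure Q)⁻¹ := inv_pos.mpr hMpos
  have key' : (intMahlerMeasure Q)⁻¹ ≤ 2 * (1 - (intMahlerMeasure Q)⁻¹ ^ 2) := by
    calc (intMahlerMeasure Q)⁻¹ = 1 * (intMahlerMeasure Q)⁻¹ := (one_mul _).symm
      _ ≤ |(a : ℝ)| * (intMahlerMeasure Q)⁻¹ := by gcongr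
      _ ≤ _ := key
  exact bound_of_quadratic hMpos key'

/-- Numerical form: a nonreciprocal integer polynomial with `P(0) ≠ 0` has `M(P) > 1.28`.
[cite: MckeeSmyth2021, §12.2.1 (12.6)–(12.10) p.209] -/
theorem intMahlerMeasure_gt_of_nonreciprocal {P : ℤ[X]} (h0 : P.coeff 0 ≠ 0) (h1 : P.reverse ≠ P)
    (h2 : P.reverse ≠ -P) : (128 : ℝ) / 100 < intMahlerMeasure P := by
  have h := intMahlerMeasure_ge_of_nonreciprocal h0 h1 h2
  have hs2 : Real.sqrt 17 ^ 2 = 17 := Real.sq_sqrt (by norm_num)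
  have hs0 : 0 ≤ Real.sqrt 17 := Real.sqrt_nonneg 17
  have : (128 : ℝ) / 100 < (1 + Real.sqrt 17) / 4 := by nlinarith [hs2, hs0]
  linarith

end Literature.NumberTheory.MahlerMeasure

end Part2

/-!
## Part 3 — port of `Summits/Ventures/DiscreteObjects/Mahler/SmythArith.lean`

# Smyth's theorem: the real-arithmetic endgames (venture `DiscreteObjects`, target L)

Cell `pub-namedobj`, seat `pub-namedobj-mahler` (gen 8). Framing: lottery ticket; floor = certified
bounds/negative ranges.

Pure inequalities between finitely many real numbers (Taylor coefficients of the Blaschke quotients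
`f, g` of a nonreciprocal integer polynomial, `c = f(0) = g(0) = 1/M(P)`), extracted from
[McKee–Smyth, *Around the Unit Circle*, §12.2.1–12.2.3]; no analysis here.

* `quad_forall_nonpos` — a concave quadratic `Aγ² + Bγ + C ≤ 0` for all `γ` has `B² - 4AC ≤ 0`
  (and `B = 0` if `A = 0`);
* `smyth_orderK` — (12.10)/(12.11): from `f_k = g_k + a c`, `|f_k|, |g_k| ≤ 1 - c²`, `c ≥ 3/4`:
  `a = ±1`, `|f_k| + |g_k| = c`, `c/2 ≤ 1 - c²`;
* `smyth_b_bound` — `|a_ℓ| = 1` (the step after (12.11));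
* `smyth_caseA_arith` — §12.2.2: the family of Parseval inequalities
  `5c²/4 + (x+γc)² + (c/2 + x/2 - γc/2 + βc)² ≤ 2 + γ² + β²` (all real `β, γ`) forces `c² + c³ ≤ 1`
  (via `40c⁴ - 93c² + 40 ≥ 0`; the degenerate case `4c⁴ - 9c² + 4 = 0` is handled by `|x| ≤ 1 - c²`);
* `smyth_caseB_arith` — §12.2.3, (12.18) ⟹ `1 - c² - c³ ≥ 0`.
The conclusion `c² + c³ ≤ 1` is `M³ ≥ M + 1`, i.e. `M ≥ θ₀`, for `M = 1/c`.
-/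

section Part3

namespace Literature.NumberTheory.MahlerMeasure

open Literature.Analysis.Complex Literature.Analysis.Complex.SchurAlgorithm

/-- A quadratic `Aγ² + Bγ + C` with `A ≤ 0` which is `≤ 0` for every real `γ` has nonpositive
discriminant `B² - 4AC ≤ 0`, and `B = 0` when `A = 0`.
[cite: MckeeSmyth2021, §12.2.2–§12.2.3 (Lemmas 12.17–12.19) pp.209–214] -/
theorem quad_forall_nonpos {A B C : ℝ} (hA : A ≤ 0) (h : ∀ γ : ℝ, A * γ ^ 2 + B * γ + C ≤ 0) :
    B ^ 2 - 4 * A * C ≤ 0 ∧ (A = 0 → B = 0) := by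
  have hB0 : A = 0 → B = 0 := by
    intro hA0
    by_contra hB
    have h1 := h ((1 - C) / B)
    rw [hA0] at h1
    have : B * ((1 - C) / B) = 1 - C := by field_simp
    linarith
  refine ⟨?_, hB0⟩
  rcases lt_or_eq_of_le hA with hAlt | hAeq
  · have h1 := h (-B / (2 * A))
    have hA0 : A ≠ 0 := ne_of_lt hAlt
    have key : A * (-B / (2 * A)) ^ 2 + B * (-B / (2 * A)) + C = (4 * A * C - B ^ 2) / (4 * A) := by
      field_simp
      ring
    rw [key, div_le_iff_of_neg (by linarith)] at h1
    linarith
  · have hB : B = 0 := hB0 hAeq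
    rw [hB, hAeq]; simp

/-- **(12.10)–(12.11).**  If `f_k = g_k + a c` with an integer `a ≠ 0`, `|f_k|, |g_k| ≤ 1 - c²` and
`3/4 ≤ c`, then `a = ±1`, `|f_k| + |g_k| = c` and `c/2 ≤ 1 - c²`.
[cite: MckeeSmyth2021, §12.2.2–§12.2.3 (Lemmas 12.17–12.19) pp.209–214] -/
theorem smyth_orderK {c Fk Gk : ℝ} {a : ℤ} (hc : 3 / 4 ≤ c) (hF : |Fk| ≤ 1 - c ^ 2)
    (hG : |Gk| ≤ 1 - c ^ 2) (ha : a ≠ 0) (hrel : Fk = Gk + a * c) :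
    (a = 1 ∨ a = -1) ∧ |Fk| + |Gk| = c ∧ c / 2 ≤ 1 - c ^ 2 := by
  have hFG : |Fk - Gk| ≤ 2 * (1 - c ^ 2) := by
    calc |Fk - Gk| ≤ |Fk| + |Gk| := abs_sub _ _
      _ ≤ _ := by linarith
  have hdiff : Fk - Gk = a * c := by linarith
  rw [hdiff, abs_mul, abs_of_pos (by linarith : (0 : ℝ) < c)] at hFG
  have hsmall : 1 - c ^ 2 < c := by nlinarith
  -- `|a| < 2`
  have ha2 : |(a : ℝ)| < 2 := by
    by_contra hge
    push Not at hge
    have : 2 * c ≤ |(a : ℝ)| * c := by nlinarith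
    nlinarith
  have ha1 : a = 1 ∨ a = -1 := by
    have : |a| < 2 := by
      have h' : ((|a| : ℤ) : ℝ) < 2 := by rw [Int.cast_abs]; exact ha2
      exact_mod_cast h'
    rcases abs_lt.mp this with ⟨h1, h2⟩
    omega
  refine ⟨ha1, ?_, ?_⟩
  · rcases ha1 with h1 | h1
    · rw [h1] at hrel; push_cast at hrel
      have hGneg : Gk ≤ 0 := by
        have := (abs_le.mp hF).2; linarith
      have hFpos : 0 ≤ Fk := by
        have := (abs_le.mp hG).1; linarith
      rw [abs_of_nonneg hFpos, abs_of_nonpos hGneg]; linarith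
    · rw [h1] at hrel; push_cast at hrel
      have hFneg : Fk ≤ 0 := by
        have := (abs_le.mp hG).2; linarith
      have hGpos : 0 ≤ Gk := by
        have := (abs_le.mp hF).1; linarith
      rw [abs_of_nonpos hFneg, abs_of_nonneg hGpos]; linarith
  · have h1 : (1 : ℝ) ≤ |(a : ℝ)| := by
      rcases ha1 with h | h <;> rw [h] <;> simp
    nlinarith

/-- **`|a_ℓ| = 1`.**  If `f_ℓ = g_ℓ + a g_{ℓ-k} + b c` with `a = ±1`, an integer `b ≠ 0`, all three
coefficients bounded by `1 - c²` and `c ≥ 3/4`, then `b = ±1`.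
[cite: MckeeSmyth2021, §12.2.2–§12.2.3 (Lemmas 12.17–12.19) pp.209–214] -/
theorem smyth_b_bound {c Fl Gl Glk : ℝ} {a b : ℤ} (hc : 3 / 4 ≤ c) (ha : a = 1 ∨ a = -1)
    (hFl : |Fl| ≤ 1 - c ^ 2) (hGl : |Gl| ≤ 1 - c ^ 2) (hGlk : |Glk| ≤ 1 - c ^ 2)
    (hb : b ≠ 0) (hrel : Fl = Gl + a * Glk + b * c) : b = 1 ∨ b = -1 := by
  have habs : |(a : ℝ) * Glk| ≤ 1 - c ^ 2 := by
    rw [abs_mul]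
    rcases ha with h | h <;> rw [h] <;> simp [hGlk]
  have hbc : |(b : ℝ)| * c ≤ 3 * (1 - c ^ 2) := by
    have e : (b : ℝ) * c = Fl - Gl - a * Glk := by linarith
    have : |(b : ℝ) * c| ≤ |Fl| + |Gl| + |(a : ℝ) * Glk| := by
      rw [e]
      calc |Fl - Gl - a * Glk| ≤ |Fl - Gl| + |(a : ℝ) * Glk| := abs_sub _ _
        _ ≤ |Fl| + |Gl| + |(a : ℝ) * Glk| := by linarith [abs_sub Fl Gl]
    rw [abs_mul, abs_of_pos (by linarith : (0 : ℝ) < c)] at this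
    linarith
  have hb2 : |(b : ℝ)| < 2 := by
    by_contra hge
    push Not at hge
    have : 2 * c ≤ |(b : ℝ)| * c := by nlinarith
    nlinarith
  have : |b| < 2 := by
    have h' : ((|b| : ℤ) : ℝ) < 2 := by rw [Int.cast_abs]; exact hb2
    exact_mod_cast h'
  rcases abs_lt.mp this with ⟨h1, h2⟩
  omega

set_option maxHeartbeats 400000 in
/-- **§12.2.2 endgame.**  If `3/4 ≤ c`, `c/2 ≤ 1 - c²`, `|x| ≤ 1 - c²` and, for all real `β, γ`,
`5c²/4 + (x + γc)² + (c/2 + x/2 - γc/2 + βc)² ≤ 2 + γ² + β²`, then `c² + c³ ≤ 1`.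
[cite: MckeeSmyth2021, §12.2.2–§12.2.3 (Lemmas 12.17–12.19) pp.209–214] -/
theorem smyth_caseA_arith {c x : ℝ} (hc : 3 / 4 ≤ c) (hc2 : c / 2 ≤ 1 - c ^ 2) (hx : |x| ≤ 1 - c ^ 2)
    (h : ∀ β γ : ℝ, 5 * c ^ 2 / 4 + (x + γ * c) ^ 2 + (c / 2 + x / 2 - γ * c / 2 + β * c) ^ 2 ≤
      2 + γ ^ 2 + β ^ 2) : c ^ 2 + c ^ 3 ≤ 1 := by
  have hc78 : c ≤ 781 / 1000 := by nlinarith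
  have h1c : 0 < 1 - c ^ 2 := by nlinarith
  obtain ⟨hxlo, hxhi⟩ := abs_le.mp hx
  -- the quadratic in `γ` obtained by optimising `β`
  set D2 : ℝ := 4 * c ^ 4 - 9 * c ^ 2 + 4 with hD2def
  set B : ℝ := 2 * c * (x * (3 - 4 * c ^ 2) - c) with hBdef
  set C0 : ℝ := 4 * (1 - c ^ 2) * (5 * c ^ 2 / 4 - 2) + 4 * (1 - c ^ 2) * x ^ 2 + (c + x) ^ 2 with hC0def
  have hD2nn : 0 ≤ D2 := by
    have e : D2 = (2 * c ^ 2 + c - 2) * (2 * c ^ 2 - c - 2) := by rw [hD2def]; ring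
    rw [e]
    apply mul_nonneg_of_nonpos_of_nonpos <;> nlinarith
  have hquad : ∀ γ : ℝ, (-D2) * γ ^ 2 + B * γ + C0 ≤ 0 := by
    intro γ
    set K : ℝ := (c + x - γ * c) / 2 with hK
    have hh := h (K * c / (1 - c ^ 2)) γ
    have iden : 4 * (1 - c ^ 2) * (5 * c ^ 2 / 4 + (x + γ * c) ^ 2 +
        (c / 2 + x / 2 - γ * c / 2 + K * c / (1 - c ^ 2) * c) ^ 2 - (2 + γ ^ 2 + (K * c / (1 - c ^ 2)) ^ 2))
        = (-D2) * γ ^ 2 + B * γ + C0 := by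
      rw [hD2def, hBdef, hC0def, hK]
      field_simp
      ring
    have : 4 * (1 - c ^ 2) * (5 * c ^ 2 / 4 + (x + γ * c) ^ 2 +
        (c / 2 + x / 2 - γ * c / 2 + K * c / (1 - c ^ 2) * c) ^ 2 - (2 + γ ^ 2 + (K * c / (1 - c ^ 2)) ^ 2))
        ≤ 0 := by
      apply mul_nonpos_of_nonneg_of_nonpos (by linarith) (by linarith)
    linarith
  obtain ⟨hdisc, hdeg⟩ := quad_forall_nonpos (by linarith) hquad
  -- `Φ = B² + 4·D2·C0 ≤ 0`
  have hΦ : B ^ 2 + 4 * D2 * C0 ≤ 0 := by linarith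
  by_cases hD : D2 = 0
  · -- degenerate case: `B = 0`, i.e. `x (3 - 4c²) = c`, impossible for `|x| ≤ 1 - c²`
    exfalso
    have hB : B = 0 := hdeg (by linarith)
    have hcx : x * (3 - 4 * c ^ 2) = c := by
      have : 2 * c * (x * (3 - 4 * c ^ 2) - c) = 0 := by rw [hBdef] at hB; exact hB
      have hc0 : (2 * c) ≠ 0 := by linarith
      have := (mul_eq_zero.mp this).resolve_left hc0
      linarith
    nlinarith
  · have hDpos : 0 < D2 := lt_of_le_of_ne hD2nn (Ne.symm hD)
    have hα : 0 < 16 * (1 - c ^ 2) * (5 - 8 * c ^ 2) := by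
      have : 0 < 5 - 8 * c ^ 2 := by nlinarith
      positivity
    -- `4αΦ = (2αx + β₁)² - 256·L·D2·(1-c²)²`
    have iden2 : 4 * (16 * (1 - c ^ 2) * (5 - 8 * c ^ 2)) * (B ^ 2 + 4 * D2 * C0) =
        (2 * (16 * (1 - c ^ 2) * (5 - 8 * c ^ 2)) * x + (64 * c ^ 5 - 96 * c ^ 3 + 32 * c)) ^ 2 -
          256 * (40 * c ^ 4 - 93 * c ^ 2 + 40) * D2 * (1 - c ^ 2) ^ 2 := by
      rw [hBdef, hC0def, hD2def]; ring
    have hL : 0 ≤ 40 * c ^ 4 - 93 * c ^ 2 + 40 := by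
      have h1 : 4 * (16 * (1 - c ^ 2) * (5 - 8 * c ^ 2)) * (B ^ 2 + 4 * D2 * C0) ≤ 0 :=
        mul_nonpos_of_nonneg_of_nonpos (by positivity) hΦ
      have h2 : 0 ≤ (2 * (16 * (1 - c ^ 2) * (5 - 8 * c ^ 2)) * x + (64 * c ^ 5 - 96 * c ^ 3 + 32 * c)) ^ 2 :=
        sq_nonneg _
      have h3 : 256 * (40 * c ^ 4 - 93 * c ^ 2 + 40) * D2 * (1 - c ^ 2) ^ 2 ≥ 0 := by linarith
      have h4 : 0 < 256 * D2 * (1 - c ^ 2) ^ 2 := by positivity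
      by_contra hneg
      push Not at hneg
      have : 256 * (40 * c ^ 4 - 93 * c ^ 2 + 40) * D2 * (1 - c ^ 2) ^ 2 < 0 := by
        have : 256 * (40 * c ^ 4 - 93 * c ^ 2 + 40) * D2 * (1 - c ^ 2) ^ 2 =
            (40 * c ^ 4 - 93 * c ^ 2 + 40) * (256 * D2 * (1 - c ^ 2) ^ 2) := by ring
        rw [this]; exact mul_neg_of_neg_of_pos hneg h4
      linarith
    -- from `40c⁴ - 93c² + 40 ≥ 0` and `3/4 ≤ c ≤ 0.781`: `c² ≤ 0.5698`, hence `c² + c³ ≤ 1`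
    have hu : c ^ 2 ≤ 5698 / 10000 := by
      by_contra hgt
      push Not at hgt
      have hu2 : c ^ 2 ≤ 62 / 100 := by nlinarith
      nlinarith
    have hc1 : c ≤ 75486 / 100000 := by nlinarith
    nlinarith

/-- **§12.2.3 endgame (12.18).**  If `3/4 ≤ c < 1`, `x ≤ 1 - c²` and
`c - x ≤ 2(1-c²) - x²/(1+c) - (c-x)²/(1-c)`, then `c² + c³ ≤ 1`.
[cite: MckeeSmyth2021, §12.2.2–§12.2.3 (Lemmas 12.17–12.19) pp.209–214] -/
theorem smyth_caseB_arith {c x : ℝ} (hc : 3 / 4 ≤ c) (hc1 : c < 1) (hx : x ≤ 1 - c ^ 2)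
    (h : c - x ≤ 2 * (1 - c ^ 2) - x ^ 2 / (1 + c) - (c - x) ^ 2 / (1 - c)) : c ^ 2 + c ^ 3 ≤ 1 := by
  have h1 : 0 < 1 - c := by linarith
  have h2 : 0 < 1 + c := by linarith
  have key : (c - x) * ((1 - c) * (1 + c)) ≤
      2 * (1 - c ^ 2) ^ 2 - x ^ 2 * (1 - c) - (c - x) ^ 2 * (1 + c) := by
    have e : 2 * (1 - c ^ 2) - x ^ 2 / (1 + c) - (c - x) ^ 2 / (1 - c) =
        (2 * (1 - c ^ 2) ^ 2 - x ^ 2 * (1 - c) - (c - x) ^ 2 * (1 + c)) / ((1 - c) * (1 + c)) := by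
      field_simp; ring
    rw [e, le_div_iff₀ (by positivity)] at h
    exact h
  -- identity: RHS - LHS = -[2(x-(1-c²))² + (3-5c)(1+c)(x-(1-c²)) - (1+c)(1-c²-c³)]
  have hprod : 0 ≤ (5 * c - 3) * (1 + c) * (1 - c ^ 2 - x) := by
    apply mul_nonneg (mul_nonneg (by linarith) h2.le) (by linarith)
  nlinarith [sq_nonneg (x - (1 - c ^ 2))]

end Literature.NumberTheory.MahlerMeasure

end Part3

/-!
## Part 4 — port of `Summits/Ventures/DiscreteObjects/Mahler/SmythAnalytic.lean`

# Smyth's theorem: the analytic core (venture `DiscreteObjects`, target L)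

Cell `pub-namedobj`, seat `pub-namedobj-mahler` (gen 8). Framing: lottery ticket; floor = certified
bounds/negative ranges.

The function-theoretic heart of [McKee–Smyth, *Around the Unit Circle*, §12.2.1–12.2.3] (Smyth 1971),
abstracted from the polynomial: a pair of Schur functions `f, g` with REAL Taylor coefficients
`fₙ, gₙ`, `f₀ = g₀ = c ∈ (0,1)` (`SmythData f g c`), linked by the "nonreciprocity relations"

  `fₙ = gₙ + a·g_{n-k}·[k ≤ n] + b·c·[n = ℓ]`   (`n ≤ ℓ`, integers `a, b ≠ 0`, `1 ≤ k < ℓ`)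

(which is what `f·P* = ε P·g` and `εP = P*(1 + aX^k + bX^ℓ) + O(X^{ℓ+1})` give), must have
`c² + c³ ≤ 1`, i.e. `M = 1/c` satisfies `M³ ≥ M + 1`, i.e. `M ≥ θ₀` (`smyth_analytic`).

* `SmythData.caseA` (`ℓ < 2k`, §12.2.2, via `parseval4` and `smyth_caseA_arith`),
  `SmythData.caseB` (no `z^{2k}` term, §12.2.3, via Prop. 12.11(d) and `smyth_caseB_arith`);
* `smyth_analytic` — the case analysis `ℓ < 2k` / `ℓ > 2k` / `ℓ = 2k` with the `f ↔ g` swaps.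
-/

section Part4

namespace Literature.NumberTheory.MahlerMeasure

open Literature.Analysis.Complex Literature.Analysis.Complex.SchurAlgorithm

open _root_.Polynomial _root_.Metric _root_.Set _root_.Filter _root_.Topology _root_.Finset
open scoped ComplexConjugate

noncomputable section

/-! ### Smyth data -/

/-- A **Smyth pair**: Schur functions `f, g` with real Taylor coefficients and `f(0) = g(0) = c ∈ (0,1)`.
[cite: MckeeSmyth2021, §12.2.2–§12.2.3 pp.209–214] -/
structure SmythData (f g : ℂ → ℂ) (c : ℝ) : Prop where
  hf : IsSchurClass f
  hg : IsSchurClass g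
  freal : ∀ n, conj (jetCoeff f n) = jetCoeff f n
  greal : ∀ n, conj (jetCoeff g n) = jetCoeff g n
  f0 : jetCoeff f 0 = c
  g0 : jetCoeff g 0 = c
  cpos : 0 < c
  clt : c < 1

namespace SmythData

variable {f g : ℂ → ℂ} {c : ℝ}

/-- The roles of `f` and `g` are symmetric. [cite: MckeeSmyth2021, §12.2.2–§12.2.3 pp.209–214] -/
theorem symm (D : SmythData f g c) : SmythData g f c :=
  ⟨D.hg, D.hf, D.greal, D.freal, D.g0, D.f0, D.cpos, D.clt⟩

/-- Real parts are the coefficients. [cite: MckeeSmyth2021, §12.2.2–§12.2.3 pp.209–214] -/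
theorem re_f (D : SmythData f g c) (n : ℕ) : (((jetCoeff f n).re : ℝ) : ℂ) = jetCoeff f n :=
  Complex.conj_eq_iff_re.mp (D.freal n)

/-- `Re f₀ = c`. [cite: MckeeSmyth2021, §12.2.2–§12.2.3 pp.209–214] -/
theorem re_f0 (D : SmythData f g c) : (jetCoeff f 0).re = c := by rw [D.f0]; simp

/-- `|fₙ| ≤ 1 - c²` for `n ≥ 1` (Prop. 12.11(b)). [cite: MckeeSmyth2021, §12.2.2–§12.2.3 pp.209–214] -/
theorem abs_re_le (D : SmythData f g c) {n : ℕ} (hn : 1 ≤ n) : |(jetCoeff f n).re| ≤ 1 - c ^ 2 := by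
  have h := D.hf.norm_jetCoeff_le hn
  rw [D.f0, Complex.norm_real, Real.norm_eq_abs, abs_of_pos D.cpos] at h
  rw [← D.re_f n, Complex.norm_real, Real.norm_eq_abs] at h
  exact h

/-- Prop. 12.11(d) for `f`: bounds on `f_{2k}` in terms of `f_k` and `c`.
[cite: MckeeSmyth2021, §12.2.2–§12.2.3 pp.209–214] -/
theorem two_mul_bounds (D : SmythData f g c) {k : ℕ} (hk : 1 ≤ k) :
    (jetCoeff f (2 * k)).re ≤ 1 - c ^ 2 - (jetCoeff f k).re ^ 2 / (1 - c) ∧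
      -(1 - c ^ 2) + (jetCoeff f k).re ^ 2 / (1 + c) ≤ (jetCoeff f (2 * k)).re :=
  D.hf.jetCoeff_two_mul_real_bounds hk D.f0 (D.re_f k).symm (D.re_f (2 * k)).symm
    (by rw [abs_of_pos D.cpos]; exact D.clt)

/-- **Case `ℓ > 2k` (§12.2.3).**  Relations `f_k = g_k + a c`, `f_{2k} = g_{2k} + a g_k` with an
integer `a ≠ 0` force `c² + c³ ≤ 1`. [cite: MckeeSmyth2021, §12.2.2–§12.2.3 pp.209–214] -/
theorem caseB (D : SmythData f g c) {k : ℕ} (hk : 1 ≤ k) {a : ℤ} (ha : a ≠ 0) (hc : 3 / 4 ≤ c)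
    (hrelk : (jetCoeff f k).re = (jetCoeff g k).re + a * c)
    (hrel2k : (jetCoeff f (2 * k)).re = (jetCoeff g (2 * k)).re + a * (jetCoeff g k).re) :
    c ^ 2 + c ^ 3 ≤ 1 := by
  set Fk := (jetCoeff f k).re with hFk
  set Gk := (jetCoeff g k).re with hGk
  set F2 := (jetCoeff f (2 * k)).re with hF2
  set G2 := (jetCoeff g (2 * k)).re with hG2
  have hFb := D.abs_re_le hk
  have hGb := D.symm.abs_re_le hk
  obtain ⟨ha1, _, _⟩ := smyth_orderK hc hFb hGb ha hrelk
  obtain ⟨_, hF2lo⟩ := D.two_mul_bounds hk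
  obtain ⟨hG2hi, _⟩ := D.symm.two_mul_bounds hk
  rcases ha1 with h1 | h1
  · rw [h1] at hrelk hrel2k; push_cast at hrelk hrel2k
    have hx : Fk ≤ 1 - c ^ 2 := (abs_le.mp hFb).2
    apply smyth_caseB_arith hc D.clt hx
    have e : (c - Fk) ^ 2 = Gk ^ 2 := by
      rw [show Gk = Fk - c by linarith]; ring
    rw [e]
    linarith
  · rw [h1] at hrelk hrel2k; push_cast at hrelk hrel2k
    have hx : -Fk ≤ 1 - c ^ 2 := by have := (abs_le.mp hFb).1; linarith
    have h := smyth_caseB_arith hc D.clt hx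
    apply h
    have e1 : (c - -Fk) ^ 2 = Gk ^ 2 := by
      rw [show Gk = Fk + c by linarith]; ring
    have e2 : (-Fk) ^ 2 = Fk ^ 2 := by ring
    rw [e1, e2]
    linarith

/-- Parseval inequality of §12.2.2 for `f` with `p = 1 + γ z^{ℓ-k} - z^k + β z^ℓ`.
[cite: MckeeSmyth2021, §12.2.2–§12.2.3 pp.209–214] -/
theorem parsevalA_f (D : SmythData f g c) {k ℓ : ℕ} (hkl : k < ℓ) (hl : ℓ < 2 * k)
    (β γ : ℝ) :
    c ^ 2 + ((jetCoeff f (ℓ - k)).re + γ * c) ^ 2 +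
      ((jetCoeff f k).re + γ * (jetCoeff f (2 * k - ℓ)).re - c) ^ 2 +
      ((jetCoeff f ℓ).re + γ * (jetCoeff f k).re - (jetCoeff f (ℓ - k)).re + β * c) ^ 2 ≤
      2 + γ ^ 2 + β ^ 2 := by
  have hi : 0 < ℓ - k := by omega
  have hij : ℓ - k < k := by omega
  have h := parseval4 D.hf D.freal 1 γ (-1) β hi hij hkl
  rw [show k - (ℓ - k) = 2 * k - ℓ by omega, show ℓ - (ℓ - k) = k by omega, D.re_f0] at h
  nlinarith [h]

/-- Parseval inequality of §12.2.2 for `g` with `q = -1 - γ z^{ℓ-k} - z^k + β z^ℓ`.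
[cite: MckeeSmyth2021, §12.2.2–§12.2.3 pp.209–214] -/
theorem parsevalA_g (D : SmythData f g c) {k ℓ : ℕ} (hkl : k < ℓ) (hl : ℓ < 2 * k)
    (β γ : ℝ) :
    c ^ 2 + ((jetCoeff g (ℓ - k)).re + γ * c) ^ 2 +
      ((jetCoeff g k).re + γ * (jetCoeff g (2 * k - ℓ)).re + c) ^ 2 +
      ((jetCoeff g ℓ).re + γ * (jetCoeff g k).re + (jetCoeff g (ℓ - k)).re - β * c) ^ 2 ≤
      2 + γ ^ 2 + β ^ 2 := by
  have hi : 0 < ℓ - k := by omega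
  have hij : ℓ - k < k := by omega
  have h := parseval4 D.hg D.greal (-1) (-γ) (-1) β hi hij hkl
  rw [show k - (ℓ - k) = 2 * k - ℓ by omega, show ℓ - (ℓ - k) = k by omega, D.symm.re_f0] at h
  nlinarith [h]

/-- **Case `ℓ < 2k` with `a = +1` (§12.2.2).** [cite: MckeeSmyth2021, §12.2.2–§12.2.3 pp.209–214] -/
theorem caseA (D : SmythData f g c) {k ℓ : ℕ} (hkl : k < ℓ) (hl : ℓ < 2 * k) {b : ℤ}
    (hb : b = 1 ∨ b = -1) (hc : 3 / 4 ≤ c) (hc2 : c / 2 ≤ 1 - c ^ 2)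
    (hy : (jetCoeff f (ℓ - k)).re = (jetCoeff g (ℓ - k)).re)
    (hw : (jetCoeff f (2 * k - ℓ)).re = (jetCoeff g (2 * k - ℓ)).re)
    (hrelk : (jetCoeff f k).re = (jetCoeff g k).re + c)
    (hrell : (jetCoeff f ℓ).re = (jetCoeff g ℓ).re + (jetCoeff g (ℓ - k)).re + b * c) :
    c ^ 2 + c ^ 3 ≤ 1 := by
  have hPf := D.parsevalA_f hkl hl
  have hPg := D.parsevalA_g hkl hl
  have hyb : |(jetCoeff f (ℓ - k)).re| ≤ 1 - c ^ 2 := D.abs_re_le (n := ℓ - k) (by omega)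
  set y := (jetCoeff f (ℓ - k)).re with hy'
  set w := (jetCoeff f (2 * k - ℓ)).re with hw'
  set Fk := (jetCoeff f k).re with hFk
  set Fl := (jetCoeff f ℓ).re with hFl
  set Gk := (jetCoeff g k).re with hGk
  set Gl := (jetCoeff g ℓ).re with hGl
  rw [← hy] at hPg hrell
  rw [← hw] at hPg
  -- the averaged inequality (12.12)
  have hcomb : ∀ β γ : ℝ, 5 * c ^ 2 / 4 + (y + γ * c) ^ 2 +
      (b * c / 2 - y / 2 + γ * c / 2 + β * c) ^ 2 ≤ 2 + γ ^ 2 + β ^ 2 := by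
    intro β γ
    have h1 := hPf β γ
    have h2 := hPg β γ
    rw [hrelk, hrell] at h1
    nlinarith [h1, h2, sq_nonneg ((Gk + c + γ * w - c) + (Gk + γ * w + c)),
      sq_nonneg ((Gl + y + b * c + γ * (Gk + c) - y + β * c) + (Gl + γ * Gk + y - β * c))]
  rcases hb with hb1 | hb1
  · subst hb1
    refine smyth_caseA_arith hc hc2 (x := -y) (by rw [abs_neg]; exact hyb) (fun β' γ' => ?_)
    have := hcomb β' (-γ')
    push_cast at this
    nlinarith [this]
  · subst hb1
    refine smyth_caseA_arith hc hc2 (x := y) hyb (fun β' γ' => ?_)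
    have := hcomb (-β') γ'
    push_cast at this
    nlinarith [this]

end SmythData

/-! ### The case analysis -/

/-- **Smyth's inequality, analytic form.**  A Smyth pair whose real coefficients satisfy the
nonreciprocity relations `fₙ = gₙ + a g_{n-k} [k ≤ n] + b c [n = ℓ]` for `n ≤ ℓ`
(`1 ≤ k < ℓ`, integers `a, b ≠ 0`) has `c² + c³ ≤ 1`. [cite: MckeeSmyth2021, §12.2.2–§12.2.3 pp.209–214] -/
theorem smyth_analytic {f g : ℂ → ℂ} {c : ℝ} (D : SmythData f g c) {k ℓ : ℕ} (hk : 1 ≤ k)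
    (hkl : k < ℓ) {a b : ℤ} (ha : a ≠ 0) (hb : b ≠ 0)
    (hrel : ∀ n, n ≤ ℓ → (jetCoeff f n).re = (jetCoeff g n).re +
      (if k ≤ n then (a : ℝ) * (jetCoeff g (n - k)).re else 0) + (if n = ℓ then (b : ℝ) * c else 0)) :
    c ^ 2 + c ^ 3 ≤ 1 := by
  by_cases hc : c < 3 / 4
  · have h0 := D.cpos
    nlinarith
  push Not at hc
  -- order `k`
  have hrelk : (jetCoeff f k).re = (jetCoeff g k).re + a * c := by
    have h := hrel k hkl.le
    rw [if_pos le_rfl, if_neg (by omega), Nat.sub_self, D.symm.re_f0] at h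
    linarith
  obtain ⟨ha1, _, hc2⟩ := smyth_orderK hc (D.abs_re_le hk) (D.symm.abs_re_le hk) ha hrelk
  -- order `ℓ`: `|b| = 1`
  have hrell : (jetCoeff f ℓ).re = (jetCoeff g ℓ).re + a * (jetCoeff g (ℓ - k)).re + b * c := by
    have h := hrel ℓ le_rfl
    rw [if_pos hkl.le, if_pos rfl] at h
    exact h
  have hb1 : b = 1 ∨ b = -1 :=
    smyth_b_bound hc ha1 (D.abs_re_le (n := ℓ) (by omega)) (D.symm.abs_re_le (n := ℓ) (by omega))
      (D.symm.abs_re_le (n := ℓ - k) (by omega)) hb hrell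
  rcases Nat.lt_trichotomy ℓ (2 * k) with hlt | heq | hgt
  · -- case `ℓ < 2k`
    have hy : (jetCoeff f (ℓ - k)).re = (jetCoeff g (ℓ - k)).re := by
      have h := hrel (ℓ - k) (by omega)
      rw [if_neg (by omega), if_neg (by omega)] at h
      linarith
    have hw : (jetCoeff f (2 * k - ℓ)).re = (jetCoeff g (2 * k - ℓ)).re := by
      have h := hrel (2 * k - ℓ) (by omega)
      rw [if_neg (by omega), if_neg (by omega)] at h
      linarith
    rcases ha1 with h1 | h1
    · subst h1
      push_cast at hrelk hrell
      exact D.caseA hkl hlt hb1 hc hc2 hy hw (by linarith) (by linarith)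
    · subst h1
      push_cast at hrelk hrell
      -- swap the roles of `f` and `g`: `a' = 1`, `b' = -b`
      have hb1' : (-b) = 1 ∨ (-b) = -1 := by omega
      refine D.symm.caseA hkl hlt hb1' hc hc2 hy.symm hw.symm (by linarith) ?_
      push_cast
      linarith
  · -- case `ℓ = 2k`: swap; `b = 1` gives case B for the swapped pair, `b = -1` is impossible
    subst heq
    rw [show 2 * k - k = k by omega] at hrell
    have haa : (a : ℝ) * a = 1 := by
      rcases ha1 with h | h <;> subst h <;> norm_num
    -- the swapped relation at order `2k`
    have hrel2 : (jetCoeff g (2 * k)).re = (jetCoeff f (2 * k)).re + ((-a : ℤ) : ℝ) * (jetCoeff f k).re +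
        (1 - b) * c := by
      push_cast
      linear_combination -hrell + (a : ℝ) * hrelk + c * haa
    have hrelk' : (jetCoeff g k).re = (jetCoeff f k).re + ((-a : ℤ) : ℝ) * c := by
      push_cast; linarith
    rcases hb1 with h1 | h1
    · subst h1
      have hrel2' : (jetCoeff g (2 * k)).re =
          (jetCoeff f (2 * k)).re + ((-a : ℤ) : ℝ) * (jetCoeff f k).re := by
        rw [hrel2]; push_cast; ring
      exact D.symm.caseB hk (a := -a) (by omega) hc hrelk' hrel2'
    · subst h1
      exfalso
      have ha1' : (-a) = 1 ∨ (-a) = -1 := by omega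
      have hrel2' : (jetCoeff g (2 * k)).re =
          (jetCoeff f (2 * k)).re + ((-a : ℤ) : ℝ) * (jetCoeff f k).re + ((2 : ℤ) : ℝ) * c := by
        rw [hrel2]; push_cast; ring
      have h2 : (2 : ℤ) = 1 ∨ (2 : ℤ) = -1 :=
        smyth_b_bound hc ha1' (D.symm.abs_re_le (n := 2 * k) (by omega))
          (D.abs_re_le (n := 2 * k) (by omega)) (D.abs_re_le (n := k) hk) (by norm_num) hrel2'
      omega
  · -- case `ℓ > 2k`
    have hrel2k : (jetCoeff f (2 * k)).re = (jetCoeff g (2 * k)).re + a * (jetCoeff g k).re := by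
      have h := hrel (2 * k) hgt.le
      rw [if_pos (by omega), if_neg (by omega), show 2 * k - k = k by omega] at h
      linarith
    exact D.caseB hk ha hc hrelk hrel2k

end

end Literature.NumberTheory.MahlerMeasure

end Part4

/-!
## Part 5 — port of `Summits/Ventures/DiscreteObjects/Mahler/SmythConstant.lean`

# Smyth's constant `θ₀ = M(z³ - z - 1) = 1.3247…` in the kernel (venture `DiscreteObjects`, target L)

Cell `pub-namedobj`, seat `pub-namedobj-mahler` (gen 8). Framing: lottery ticket; floor = certified
bounds/negative ranges.

The constant of Smyth's theorem ([McKee–Smyth, *Around the Unit Circle*, Thm 12.1]: a nonreciprocal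
integer polynomial has `M ≥ θ₀`): `θ₀` is the real root of `t³ = t + 1` (the smallest Pisot number),

* `smythTheta`, `smythTheta_cube`, `smythTheta_gt`/`smythTheta_lt` — `1.3247 < θ₀ < 1.3248`
  (intermediate value theorem);
* `smythTheta_le_of_cube` — for `t ≥ 0`, `t³ ≥ t + 1` forces `θ₀ ≤ t` (monotonicity);
* `mahlerMeasure_X_cube_sub_X_sub_one` — `M(z³ - z - 1) = θ₀`, from the factorisation
  `z³ - z - 1 = (z - θ₀)(z - ζ)(z - ζ̄)` with `|ζ|² = θ₀² - 1 = 1/θ₀ < 1`;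
* `intMahlerMeasure_X_cube_sub_X_sub_one` — the same for the cell's `intMahlerMeasure`.
-/

section Part5

namespace Literature.NumberTheory.MahlerMeasure

open Literature.Analysis.Complex Literature.Analysis.Complex.SchurAlgorithm

open _root_.Polynomial
open scoped ComplexConjugate

noncomputable section

/-- There is a real number `θ` with `1.3247 < θ < 1.3248` and `θ³ = θ + 1`.
[cite: MckeeSmyth2021, §12.2.1 p.208 (θ₀ = M(z³ − z − 1))] -/
theorem exists_smythTheta :
    ∃ θ : ℝ, (13247 : ℝ) / 10000 < θ ∧ θ < 13248 / 10000 ∧ θ ^ 3 = θ + 1 := by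
  have hcont : ContinuousOn (fun t : ℝ => t ^ 3 - t - 1) (Set.Icc (13247 / 10000 : ℝ) (13248 / 10000)) :=
    by fun_prop
  have hab : (13247 : ℝ) / 10000 ≤ 13248 / 10000 := by norm_num
  have h0 : (0 : ℝ) ∈ Set.Ioo ((fun t : ℝ => t ^ 3 - t - 1) (13247 / 10000))
      ((fun t : ℝ => t ^ 3 - t - 1) (13248 / 10000)) := by
    constructor <;> norm_num
  obtain ⟨θ, ⟨h1, h2⟩, hθ⟩ := intermediate_value_Ioo hab hcont h0
  refine ⟨θ, h1, h2, ?_⟩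
  have : θ ^ 3 - θ - 1 = 0 := hθ
  linarith

/-- **Smyth's constant** `θ₀ = 1.3247…`, the real root of `t³ = t + 1` (smallest Pisot number).
[cite: MckeeSmyth2021, §12.2.1 p.208 (θ₀ = M(z³ − z − 1))] -/
def smythTheta : ℝ := Classical.choose exists_smythTheta

/-- `θ₀ > 1.3247`. [cite: MckeeSmyth2021, §12.2.1 p.208 (θ₀ = M(z³ − z − 1))] -/
theorem smythTheta_gt : (13247 : ℝ) / 10000 < smythTheta := (Classical.choose_spec exists_smythTheta).1

/-- `θ₀ < 1.3248`. [cite: MckeeSmyth2021, §12.2.1 p.208 (θ₀ = M(z³ − z − 1))] -/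
theorem smythTheta_lt : smythTheta < 13248 / 10000 := (Classical.choose_spec exists_smythTheta).2.1

/-- `θ₀³ = θ₀ + 1`. [cite: MckeeSmyth2021, §12.2.1 p.208 (θ₀ = M(z³ − z − 1))] -/
theorem smythTheta_cube : smythTheta ^ 3 = smythTheta + 1 := (Classical.choose_spec exists_smythTheta).2.2

/-- `θ₀ > 0`. [cite: MckeeSmyth2021, §12.2.1 p.208 (θ₀ = M(z³ − z − 1))] -/
theorem smythTheta_pos : 0 < smythTheta := lt_trans (by norm_num) smythTheta_gt

/-- Monotonicity: a real `t ≥ 0` with `t³ ≥ t + 1` satisfies `θ₀ ≤ t`.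
[cite: MckeeSmyth2021, §12.2.1 p.208 (θ₀ = M(z³ − z − 1))] -/
theorem smythTheta_le_of_cube {t : ℝ} (ht : 0 ≤ t) (h : t + 1 ≤ t ^ 3) : smythTheta ≤ t := by
  by_contra hlt
  push Not at hlt
  have hθ := smythTheta_cube
  have hθ1 : 1 < smythTheta := lt_trans (by norm_num) smythTheta_gt
  -- `t³ - t - 1 - (θ³ - θ - 1) = (t - θ)(t² + tθ + θ² - 1) < 0`
  have hfac : t ^ 3 - t - 1 = (t - smythTheta) * (t ^ 2 + t * smythTheta + smythTheta ^ 2 - 1) := by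
    nlinarith [hθ]
  have hpos : 0 < t ^ 2 + t * smythTheta + smythTheta ^ 2 - 1 := by nlinarith
  have hneg : (t - smythTheta) * (t ^ 2 + t * smythTheta + smythTheta ^ 2 - 1) < 0 :=
    mul_neg_of_neg_of_pos (by linarith) hpos
  linarith

/-- Equivalently: `θ₀ ≤ t` as soon as `t > 0` and `1 ≤ t²·(t - 1/t)`-type bound `1/t² + 1/t³ ≤ 1`.
[cite: MckeeSmyth2021, §12.2.1 p.208 (θ₀ = M(z³ − z − 1))] -/
theorem smythTheta_le_of_inv {t : ℝ} (ht : 0 < t) (h : (t⁻¹) ^ 2 + (t⁻¹) ^ 3 ≤ 1) : smythTheta ≤ t := by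
  apply smythTheta_le_of_cube ht.le
  have ht3 : 0 < t ^ 3 := by positivity
  have : ((t⁻¹) ^ 2 + (t⁻¹) ^ 3) * t ^ 3 ≤ 1 * t ^ 3 := by gcongr
  have e : ((t⁻¹) ^ 2 + (t⁻¹) ^ 3) * t ^ 3 = t + 1 := by field_simp
  linarith

/-! ### `M(z³ - z - 1) = θ₀` -/

/-- The polynomial `z³ - z - 1` over `ℂ` factors as `(z - θ₀)(z - ζ)(z - ζ̄)` with
`ζ = (-θ₀ + i√(3θ₀² - 4))/2`, `|ζ|² = θ₀² - 1`. [cite: MckeeSmyth2021, §12.2.1 p.208 (θ₀ = M(z³ − z − 1))] -/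
theorem X_cube_sub_X_sub_one_eq_prod :
    ∃ ζ : ℂ, ‖ζ‖ < 1 ∧
      (X ^ 3 - X - 1 : ℂ[X]) = (X - C (smythTheta : ℂ)) * (X - C ζ) * (X - C (conj ζ)) := by
  set θ : ℝ := smythTheta with hθdef
  have hθ := smythTheta_cube
  have hθgt := smythTheta_gt
  have hθlt := smythTheta_lt
  have hdisc : 0 ≤ 3 * θ ^ 2 - 4 := by nlinarith
  set s : ℝ := Real.sqrt (3 * θ ^ 2 - 4) with hs
  have hs2 : s ^ 2 = 3 * θ ^ 2 - 4 := by rw [hs]; exact Real.sq_sqrt hdisc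
  set ζ : ℂ := (-(θ : ℂ) + (s : ℂ) * Complex.I) / 2 with hζ
  have hsum : ζ + conj ζ = -(θ : ℂ) := by
    rw [hζ]; simp only [map_div₀, map_add, map_neg, Complex.conj_ofReal, map_mul, Complex.conj_I,
      map_ofNat]; ring
  have hprod : ζ * conj ζ = ((θ ^ 2 - 1 : ℝ) : ℂ) := by
    rw [hζ]; simp only [map_div₀, map_add, map_neg, Complex.conj_ofReal, map_mul, Complex.conj_I,
      map_ofNat]
    have hI : Complex.I * Complex.I = -1 := Complex.I_mul_I
    have e : (-(θ : ℂ) + (s : ℂ) * Complex.I) / 2 * ((-(θ : ℂ) + (s : ℂ) * -Complex.I) / 2) =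
        ((θ : ℂ) ^ 2 - (s : ℂ) ^ 2 * (Complex.I * Complex.I)) / 4 := by ring
    rw [e, hI]; push_cast; rw [show (s : ℂ) ^ 2 = ((s ^ 2 : ℝ) : ℂ) by push_cast; ring, hs2]
    push_cast; ring
  have hnorm : ‖ζ‖ ^ 2 = θ ^ 2 - 1 := by
    have h := Complex.mul_conj' ζ
    rw [hprod] at h
    exact_mod_cast h.symm
  have hθinv : θ ^ 2 - 1 < 1 := by nlinarith
  refine ⟨ζ, ?_, ?_⟩
  · have h0 : 0 ≤ ‖ζ‖ := norm_nonneg _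
    nlinarith
  · have e1 : (X - C (θ : ℂ)) * (X - C ζ) * (X - C (conj ζ)) =
        X ^ 3 - C ((θ : ℂ) + (ζ + conj ζ)) * X ^ 2 + C ((θ : ℂ) * (ζ + conj ζ) + ζ * conj ζ) * X
          - C ((θ : ℂ) * (ζ * conj ζ)) := by
      simp only [map_add, map_mul]; ring
    have c1 : (θ : ℂ) + (ζ + conj ζ) = 0 := by rw [hsum]; ring
    have c2 : (θ : ℂ) * (ζ + conj ζ) + ζ * conj ζ = -1 := by
      rw [hsum, hprod]; push_cast; ring
    have c3 : (θ : ℂ) * (ζ * conj ζ) = 1 := by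
      rw [hprod]; push_cast
      have : (θ : ℂ) ^ 3 = θ + 1 := by exact_mod_cast hθ
      linear_combination this
    rw [e1, c1, c2, c3, map_zero, map_neg, map_one]; ring

/-- **`M(z³ - z - 1) = θ₀`.** [cite: MckeeSmyth2021, §12.2.1 p.208 (θ₀ = M(z³ − z − 1))] -/
theorem mahlerMeasure_X_cube_sub_X_sub_one :
    (X ^ 3 - X - 1 : ℂ[X]).mahlerMeasure = smythTheta := by
  obtain ⟨ζ, hζ, hfac⟩ := X_cube_sub_X_sub_one_eq_prod
  have hθ1 : 1 ≤ smythTheta := le_trans (by norm_num) smythTheta_gt.le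
  rw [hfac, mahlerMeasure_mul, mahlerMeasure_mul, mahlerMeasure_X_sub_C, mahlerMeasure_X_sub_C,
    mahlerMeasure_X_sub_C, Complex.norm_conj, Complex.norm_real, Real.norm_eq_abs,
    abs_of_pos smythTheta_pos, max_eq_right hθ1, max_eq_left hζ.le, mul_one, mul_one]

/-- `M(z³ - z - 1) = θ₀` for the integer polynomial (cell vocabulary `intMahlerMeasure`).
[cite: MckeeSmyth2021, §12.2.1 p.208 (θ₀ = M(z³ − z − 1))] -/
theorem intMahlerMeasure_X_cube_sub_X_sub_one :
    intMahlerMeasure (X ^ 3 - X - 1 : ℤ[X]) = smythTheta := by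
  unfold intMahlerMeasure
  have : ((X ^ 3 - X - 1 : ℤ[X]).map (Int.castRingHom ℂ)) = (X ^ 3 - X - 1 : ℂ[X]) := by
    simp [Polynomial.map_sub, Polynomial.map_pow]
  rw [this, mahlerMeasure_X_cube_sub_X_sub_one]

/-- The Literature constant: `M(X³ - X - 1)` as written in `NonreciprocalMahlerBound` equals `θ₀`.
[cite: MckeeSmyth2021, §12.2.1 p.208 (θ₀ = M(z³ − z − 1))] -/
theorem mahlerMeasure_map_X_cube_sub_X_sub_one :
    ((X ^ 3 - X - 1 : ℤ[X]).map (Int.castRingHom ℂ)).mahlerMeasure = smythTheta :=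
  intMahlerMeasure_X_cube_sub_X_sub_one

end

end Literature.NumberTheory.MahlerMeasure

end Part5

/-!
## Part 6 — port of `Summits/Ventures/DiscreteObjects/Mahler/BlaschkeDataReal.lean`

# Blaschke data with conjugation symmetry (venture `DiscreteObjects`, target L)

Cell `pub-namedobj`, seat `pub-namedobj-mahler` (gen 8). Framing: lottery ticket; floor = certified
bounds/negative ranges.

For Smyth's theorem ([McKee–Smyth, *Around the Unit Circle*, §12.2]) the Blaschke quotients `f, g` of a
monic integer polynomial must have REAL Taylor coefficients.  We re-run gen 7's construction
(`BlaschkeData.exists_blaschke_data`) recording in addition the symmetry `f (z̄) = conj (f z)`,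
`g (z̄) = conj (g z)` (`exists_blaschke_data_symm`), which holds because the multiset of complex roots of
an integer polynomial is closed under conjugation (`conj_multiset_prod_sub`,
`conj_multiset_prod_one_sub_conj_mul`).
-/

section Part6

namespace Literature.NumberTheory.MahlerMeasure

open Literature.Analysis.Complex Literature.Analysis.Complex.SchurAlgorithm

open _root_.Polynomial _root_.Complex _root_.Metric _root_.Set _root_.Filter _root_.Topology
open scoped ComplexConjugate

/-- Conjugating a product `∏ (w - α)` over a conjugation-closed multiset. [cite: MckeeSmyth2021, §12.2.1 p.208] -/
theorem conj_multiset_prod_sub {T : Multiset ℂ} (hT : T.map (starRingEnd ℂ) = T) (w : ℂ) :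
    starRingEnd ℂ ((T.map fun α => w - α).prod) = (T.map fun α => starRingEnd ℂ w - α).prod := by
  rw [map_multiset_prod, Multiset.map_map]
  conv_rhs => rw [← hT, Multiset.map_map]
  congr 1
  apply Multiset.map_congr rfl
  intro α _
  simp [map_sub]

/-- Conjugating a product `∏ (1 - ᾱ w)` over a conjugation-closed multiset. [cite: MckeeSmyth2021, §12.2.1 p.208] -/
theorem conj_multiset_prod_one_sub_conj_mul {T : Multiset ℂ} (hT : T.map (starRingEnd ℂ) = T) (w : ℂ) :
    starRingEnd ℂ ((T.map fun α => 1 - starRingEnd ℂ α * w).prod) =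
      (T.map fun α => 1 - starRingEnd ℂ α * starRingEnd ℂ w).prod := by
  rw [map_multiset_prod, Multiset.map_map]
  conv_rhs => rw [← hT, Multiset.map_map]
  congr 1
  apply Multiset.map_congr rfl
  intro α _
  simp [map_sub, map_mul]

/-- **Blaschke data with conjugation symmetry.**  For `P` monic with `P(0) = ε`, `ε² = 1`, there are
`f, g` holomorphic on the unit disc, bounded by `1` there, with `f · P* = ε · P · g` on the disc,
`‖g 0‖ = 1/M(P)`, `f 0 = g 0`, and the symmetry `f (conj z) = conj (f z)`, `g (conj z) = conj (g z)`
(so all Taylor coefficients of `f` and `g` are real).  Same construction as gen 7's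
`exists_blaschke_data` (`f = ε ∏_{‖α‖≤1} (z-α)/(1-ᾱz)`, `g = ∏_{‖α‖>1} (1-ᾱz)/(z-α)` over the complex
roots of `P`, a multiset closed under conjugation). [cite: MckeeSmyth2021, §12.2.1 p.208] -/
theorem exists_blaschke_data_symm {P : ℤ[X]} (hmonic : P.Monic) {ε : ℤ} (hε : P.coeff 0 = ε)
    (hε1 : ε * ε = 1) :
    ∃ f g : ℂ → ℂ, DifferentiableOn ℂ f (ball 0 1) ∧ DifferentiableOn ℂ g (ball 0 1) ∧
      (∀ z ∈ ball (0 : ℂ) 1, ‖f z‖ ≤ 1) ∧ (∀ z ∈ ball (0 : ℂ) 1, ‖g z‖ ≤ 1) ∧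
      (∀ z ∈ ball (0 : ℂ) 1, f z * (P.reverse.map (Int.castRingHom ℂ)).eval z =
        (ε : ℂ) * (P.map (Int.castRingHom ℂ)).eval z * g z) ∧
      ‖g 0‖ = (intMahlerMeasure P)⁻¹ ∧ f 0 = g 0 ∧
      (∀ z, f (starRingEnd ℂ z) = starRingEnd ℂ (f z)) ∧
      (∀ z, g (starRingEnd ℂ z) = starRingEnd ℂ (g z)) := by
  classical
  set Pc := P.map (Int.castRingHom ℂ) with hPc
  have hPcm : Pc.Monic := hmonic.map _
  set S := Pc.roots with hSdef
  have hcard : Multiset.card S = Pc.natDegree := IsAlgClosed.card_roots_eq_natDegree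
  have hprod : (S.map fun α => X - C α).prod = Pc :=
    prod_multiset_X_sub_C_of_monic_of_roots_card_eq hPcm hcard
  set S₁ := S.filter fun α => ‖α‖ ≤ 1 with hS₁
  set S₂ := S.filter fun α => ¬ ‖α‖ ≤ 1 with hS₂
  have hS : S₁ + S₂ = S := Multiset.filter_add_not _ S
  have hS₁conj : S₁.map (starRingEnd ℂ) = S₁ :=
    filter_roots_map_conj P _ (fun α => by rw [Complex.norm_conj])
  have hS₂conj : S₂.map (starRingEnd ℂ) = S₂ :=
    filter_roots_map_conj P _ (fun α => by rw [Complex.norm_conj])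
  have hmem₁ : ∀ α ∈ S₁, ‖α‖ ≤ 1 := fun α hα => (Multiset.mem_filter.mp hα).2
  have hmem₂ : ∀ α ∈ S₂, 1 ≤ ‖α‖ := fun α hα => (not_le.mp (Multiset.mem_filter.mp hα).2).le
  have hmem₂' : ∀ α ∈ S₂, 1 < ‖α‖ := fun α hα => not_le.mp (Multiset.mem_filter.mp hα).2
  -- the four polynomials
  set A : ℂ[X] := (S₁.map fun α => X - C α).prod with hA
  set B : ℂ[X] := (S₂.map fun α => X - C α).prod with hB
  set Abar : ℂ[X] := (S₁.map fun α => (1 : ℂ[X]) - C (starRingEnd ℂ α) * X).prod with hAbar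
  set Bbar : ℂ[X] := (S₂.map fun α => (1 : ℂ[X]) - C (starRingEnd ℂ α) * X).prod with hBbar
  have hPAB : Pc = A * B := by
    rw [← hprod, ← hS, Multiset.map_add, Multiset.prod_add]
  have hconj_prod : ∀ T : Multiset ℂ, T.map (starRingEnd ℂ) = T →
      (T.map fun α => (1 : ℂ[X]) - C (starRingEnd ℂ α) * X).prod =
        (T.map fun α => (1 : ℂ[X]) - C α * X).prod := by
    intro T hT
    conv_rhs => rw [← hT, Multiset.map_map]
    rfl
  have hPrev : Pc.reverse = Abar * Bbar := by
    rw [← hprod, reverse_multiset_prod_X_sub_C, ← hS, Multiset.map_add, Multiset.prod_add,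
      ← hconj_prod S₁ hS₁conj, ← hconj_prod S₂ hS₂conj]
  have hPrev' : P.reverse.map (Int.castRingHom ℂ) = Abar * Bbar := by
    rw [← reverse_map_intCast, ← hPc, hPrev]
  -- evaluations
  have hAe : ∀ z, A.eval z = (S₁.map fun α => z - α).prod := fun z => eval_multiset_prod_X_sub_C S₁ z
  have hBe : ∀ z, B.eval z = (S₂.map fun α => z - α).prod := fun z => eval_multiset_prod_X_sub_C S₂ z
  have hAbe : ∀ z, Abar.eval z = (S₁.map fun α => 1 - starRingEnd ℂ α * z).prod := fun z =>
    eval_multiset_prod_one_sub_C_mul_X S₁ _ z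
  have hBbe : ∀ z, Bbar.eval z = (S₂.map fun α => 1 - starRingEnd ℂ α * z).prod := fun z =>
    eval_multiset_prod_one_sub_C_mul_X S₂ _ z
  -- nonvanishing on the disc
  have hAbar0 : ∀ z ∈ ball (0 : ℂ) 1, Abar.eval z ≠ 0 := by
    intro z hz
    rw [hAbe]
    apply multiset_prod_ne_zero
    intro α hα h0
    have h1 : starRingEnd ℂ α * z = 1 := (sub_eq_zero.mp h0).symm
    have h2 : ‖starRingEnd ℂ α * z‖ < 1 := by
      rw [norm_mul, Complex.norm_conj]
      have := hmem₁ α hα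
      have hz' := mem_ball_zero_iff.mp hz
      calc ‖α‖ * ‖z‖ ≤ 1 * ‖z‖ := by gcongr
        _ < 1 := by rw [one_mul]; exact hz'
    rw [h1, norm_one] at h2
    exact lt_irrefl _ h2
  have hB0 : ∀ z ∈ ball (0 : ℂ) 1, B.eval z ≠ 0 := by
    intro z hz
    rw [hBe]
    apply multiset_prod_ne_zero
    intro α hα h0
    have h1 : z = α := sub_eq_zero.mp h0
    have := hmem₂' α hα
    rw [← h1] at this
    exact absurd (mem_ball_zero_iff.mp hz) (not_lt.mpr this.le)
  -- the functions
  refine ⟨fun z => (ε : ℂ) * A.eval z / Abar.eval z, fun z => Bbar.eval z / B.eval z,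
    ?_, ?_, ?_, ?_, ?_, ?_, ?_, ?_, ?_⟩
  · -- differentiability of f
    apply DifferentiableOn.div _ _ hAbar0
    · exact ((Polynomial.differentiable A).const_mul _).differentiableOn
    · exact (Polynomial.differentiable Abar).differentiableOn
  · apply DifferentiableOn.div _ _ hB0
    · exact (Polynomial.differentiable Bbar).differentiableOn
    · exact (Polynomial.differentiable B).differentiableOn
  · -- bound for f
    intro z hz
    have hz' : ‖z‖ ≤ 1 := (mem_ball_zero_iff.mp hz).le
    have hεn : ‖(ε : ℂ)‖ = 1 := by
      have : ((ε : ℂ)) * (ε : ℂ) = 1 := by exact_mod_cast hε1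
      have h := congrArg norm this
      rw [norm_mul, norm_one] at h
      nlinarith [norm_nonneg (ε : ℂ)]
    rw [norm_div, norm_mul, hεn, one_mul]
    apply div_le_one_of_le₀ _ (norm_nonneg _)
    rw [hAe, hAbe]
    exact norm_multiset_prod_le fun α hα => norm_sub_le_norm_one_sub_conj_mul (hmem₁ α hα) hz'
  · -- bound for g
    intro z hz
    have hz' : ‖z‖ ≤ 1 := (mem_ball_zero_iff.mp hz).le
    rw [norm_div]
    apply div_le_one_of_le₀ _ (norm_nonneg _)
    rw [hBe, hBbe]
    exact norm_multiset_prod_le fun α hα => norm_one_sub_conj_mul_le_norm_sub (hmem₂ α hα) hz'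
  · -- the identity f · P* = ε P g
    intro z hz
    simp only
    rw [hPrev', hPAB, eval_mul, eval_mul]
    field_simp [hAbar0 z hz, hB0 z hz]
  · -- ‖g 0‖ = 1/M
    have hB0e : ‖B.eval 0‖ = (S₂.map fun α => ‖α‖).prod := by
      rw [hBe, norm_multiset_prod_eq]
      congr 1
      apply Multiset.map_congr rfl
      intro α _; simp
    have hBb0e : Bbar.eval 0 = 1 := by
      rw [hBbe]; simp
    have hM : intMahlerMeasure P = (S₂.map fun α => ‖α‖).prod := by
      unfold intMahlerMeasure
      rw [← hPc, mahlerMeasure_eq_leadingCoeff_mul_prod_roots, hPcm.leadingCoeff, norm_one, one_mul,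
        ← hSdef, ← hS, Multiset.map_add, Multiset.prod_add]
      have h1 : (S₁.map fun α => max 1 ‖α‖).prod = 1 := by
        apply Multiset.prod_eq_one
        intro x hx
        obtain ⟨α, hα, rfl⟩ := Multiset.mem_map.mp hx
        exact max_eq_left (hmem₁ α hα)
      have h2 : (S₂.map fun α => max 1 ‖α‖) = S₂.map fun α => ‖α‖ := by
        apply Multiset.map_congr rfl
        intro α hα
        exact max_eq_right (hmem₂ α hα)
      rw [h1, h2, one_mul]
    simp only
    rw [norm_div, hBb0e, norm_one, hB0e, hM, one_div]
  · -- f 0 = g 0, from the identity at 0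
    have hPc0 : Pc.eval 0 = (ε : ℂ) := by
      rw [← coeff_zero_eq_eval_zero, hPc, coeff_map, hε]; simp
    have hPr0 : (P.reverse.map (Int.castRingHom ℂ)).eval 0 = 1 := by
      rw [← coeff_zero_eq_eval_zero, coeff_map, coeff_zero_reverse, hmonic.leadingCoeff]; simp
    have hεε : ((ε : ℂ)) * (ε : ℂ) = 1 := by exact_mod_cast hε1
    have hAbar00 : Abar.eval 0 ≠ 0 := hAbar0 0 (mem_ball_self one_pos)
    have hB00 : B.eval 0 ≠ 0 := hB0 0 (mem_ball_self one_pos)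
    have hid : (ε : ℂ) * A.eval 0 / Abar.eval 0 * (P.reverse.map (Int.castRingHom ℂ)).eval 0 =
        (ε : ℂ) * Pc.eval 0 * (Bbar.eval 0 / B.eval 0) := by
      rw [hPrev', hPAB, eval_mul, eval_mul]
      field_simp
    rw [hPr0, mul_one, hPc0] at hid
    simp only
    rw [hid, hεε, one_mul]
  · -- conjugation symmetry of f
    intro z
    simp only
    rw [map_div₀, map_mul, map_intCast, hAe, hAe, hAbe, hAbe,
      conj_multiset_prod_sub hS₁conj, conj_multiset_prod_one_sub_conj_mul hS₁conj]
  · -- conjugation symmetry of g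
    intro z
    simp only
    rw [map_div₀, hBe, hBe, hBbe, hBbe, conj_multiset_prod_sub hS₂conj,
      conj_multiset_prod_one_sub_conj_mul hS₂conj]

end Literature.NumberTheory.MahlerMeasure

end Part6

/-!
## Part 7 — port of `Summits/Ventures/DiscreteObjects/Mahler/SmythTheorem.lean` (6 declarations kept)

# Smyth's theorem: nonreciprocal integer polynomials have `M(P) ≥ θ₀ = 1.3247…`
(venture `DiscreteObjects`, target L)

Cell `pub-namedobj`, seat `pub-namedobj-mahler` (gen 8). Framing: lottery ticket; floor = certified
bounds/negative ranges.

**Theorem** (Smyth 1971; [McKee–Smyth, *Around the Unit Circle*, Thm 12.1]).  If `P ∈ ℤ[X]` has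
`P(0) ≠ 0` and is neither reciprocal nor antireciprocal (`P.reverse ≠ ± P`), then
`M(P) ≥ θ₀ = M(z³ - z - 1) = 1.3247…` (`intMahlerMeasure_ge_smythTheta_of_nonreciprocal`).
No irreducibility hypothesis is needed.  As a corollary the Literature named fact
`Literature.NumberTheory.MahlerMeasure.NonreciprocalMahlerBound` (typed statement of Thm 12.1 for
irreducible `P`) is PROVED (`nonreciprocalMahlerBound_holds`), so the census kernel of target L no
longer depends on it as a hypothesis anywhere.

Proof (kernel files of this seat): integer side `exists_second_nonpalindromic_coeff`
(`εP = P*(1 + aX^k) + bX^ℓ + X^{ℓ+1}R`, `a, b ≠ 0`, `1 ≤ k < ℓ`); complex side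
`BlaschkeDataReal.exists_blaschke_data_symm` (Schur functions `f, g`, real coefficients,
`f·P* = εP·g`, `|g(0)| = 1/M`); the coefficient relations `smyth_relations` (Taylor jets,
`TaylorJet*`); the analytic inequality `SmythAnalytic.smyth_analytic` (`c² + c³ ≤ 1` for `c = 1/M`,
from Schwarz–Pick `SchwarzPickHigher`, Parseval `HardyContraction`/`Parseval4` and the endgames
`SmythArith`); and `SmythConstant` (`M(z³-z-1) = θ₀`, `t³ ≥ t+1 ⇒ t ≥ θ₀`).
-/

section Part7

namespace Literature.NumberTheory.MahlerMeasure

open Literature.Analysis.Complex Literature.Analysis.Complex.SchurAlgorithm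

open _root_.Polynomial _root_.Metric _root_.Set _root_.Filter _root_.Topology _root_.Finset
open scoped ComplexConjugate

noncomputable section

/-! ### Integer side: the first two non-palindromic coefficients -/

/-- For `P` monic with `P(0) = ε = ±1` and `P.reverse ≠ ε P`: there are `1 ≤ k < ℓ`, nonzero integers
`a, b` and `R ∈ ℤ[X]` with `ε P = P.reverse · (1 + a X^k) + b X^ℓ + X^{ℓ+1} R` (the first two
nonzero coefficients `a_k = a`, `a_ℓ = b` of the power series `ε P / P* - 1`).
[cite: MckeeSmyth2021, Theorem 12.1 p.205] -/
theorem exists_second_nonpalindromic_coeff {P : ℤ[X]} (hmonic : P.Monic) {ε : ℤ}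
    (hε : P.coeff 0 = ε) (hε1 : ε * ε = 1) (hne : P.reverse ≠ C ε * P) :
    ∃ (k ℓ : ℕ) (a b : ℤ) (R : ℤ[X]), 1 ≤ k ∧ k < ℓ ∧ a ≠ 0 ∧ b ≠ 0 ∧
      C ε * P = P.reverse * (1 + C a * X ^ k) + C b * X ^ ℓ + X ^ (ℓ + 1) * R := by
  obtain ⟨k, a, R, hk, ha, hid⟩ := exists_first_nonpalindromic_coeff hmonic hε hε1 hne
  have hε0 : ε ≠ 0 := by rintro rfl; simp at hε1
  have hP0 : P ≠ 0 := hmonic.ne_zero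
  -- `R ≠ 0` by a degree count
  have hR0 : R ≠ 0 := by
    intro hR
    rw [hR, mul_zero, add_zero] at hid
    have h1 : (C ε * P).natDegree = P.natDegree := natDegree_C_mul hε0
    have hrev : P.reverse.natDegree = P.natDegree := by
      rw [reverse_natDegree, natTrailingDegree_eq_zero_of_constantCoeff_ne_zero, Nat.sub_zero]
      rw [constantCoeff_apply, hε]; exact hε0
    have hrev0 : P.reverse ≠ 0 := by
      intro h; exact hP0 (Polynomial.reverse_eq_zero.mp h)
    have h2 : (1 + C a * X ^ k : ℤ[X]).natDegree = k := by
      rw [add_comm, natDegree_add_eq_left_of_natDegree_lt] <;>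
        rw [natDegree_C_mul_X_pow k a ha]
      simp only [natDegree_one]; omega
    have h3 : (P.reverse * (1 + C a * X ^ k)).natDegree = P.natDegree + k := by
      rw [natDegree_mul hrev0, hrev, h2]
      intro h; rw [h, natDegree_zero] at h2; omega
    have := congrArg natDegree hid
    rw [h1, h3] at this
    omega
  -- peel off the lowest term of `R`
  set j := R.natTrailingDegree with hj
  set b := R.coeff j with hb
  have hb0 : b ≠ 0 := by
    rw [hb, hj]; exact trailingCoeff_eq_zero.not.mpr hR0
  have hdvd : X ^ (j + 1) ∣ R - C b * X ^ j := by
    rw [X_pow_dvd_iff]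
    intro d hd
    rw [coeff_sub, coeff_C_mul_X_pow]
    by_cases hdj : d = j
    · subst hdj; simp [hb]
    · rw [if_neg hdj, sub_zero]
      exact coeff_eq_zero_of_lt_natTrailingDegree (by omega)
  obtain ⟨R', hR'⟩ := hdvd
  refine ⟨k, k + 1 + j, a, b, R', hk, by omega, ha, hb0, ?_⟩
  have hR : R = C b * X ^ j + X ^ (j + 1) * R' := by rw [← hR']; ring
  rw [hid, hR]
  ring

/-! ### Complex side: the coefficient relations -/

/-- **The nonreciprocity relations.**  If `P` is monic, `ε P = P* (1 + a X^k) + b X^ℓ + X^{ℓ+1} R`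
over `ℤ`, and `f, g` are holomorphic on the unit disc with `f · P* = ε · P · g` there, then for
`n ≤ ℓ` the Taylor coefficients satisfy `fₙ = gₙ + a g_{n-k} [k ≤ n] + b g(0) [n = ℓ]`.
[cite: MckeeSmyth2021, Theorem 12.1 p.205] -/
theorem smyth_relations {P : ℤ[X]} (hmonic : P.Monic) {ε : ℤ} {k ℓ : ℕ} {a b : ℤ} {R : ℤ[X]}
    (hid : C ε * P = P.reverse * (1 + C a * X ^ k) + C b * X ^ ℓ + X ^ (ℓ + 1) * R)
    {f g : ℂ → ℂ} (hf : DifferentiableOn ℂ f (ball 0 1)) (hg : DifferentiableOn ℂ g (ball 0 1))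
    (hfg : ∀ z ∈ ball (0 : ℂ) 1, f z * (P.reverse.map (Int.castRingHom ℂ)).eval z =
      (ε : ℂ) * (P.map (Int.castRingHom ℂ)).eval z * g z) :
    ∀ n, n ≤ ℓ → jetCoeff f n = jetCoeff g n + (if k ≤ n then (a : ℂ) * jetCoeff g (n - k) else 0) +
      (if n = ℓ then (b : ℂ) * g 0 else 0) := by
  set Pc := P.map (Int.castRingHom ℂ)
  set Prc := P.reverse.map (Int.castRingHom ℂ) with hPrc
  set Rc := R.map (Int.castRingHom ℂ)
  have hidC : ∀ w : ℂ, (ε : ℂ) * Pc.eval w =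
      Prc.eval w * (1 + (a : ℂ) * w ^ k) + (b : ℂ) * w ^ ℓ + w ^ (ℓ + 1) * Rc.eval w := by
    intro w
    have h := congrArg (fun Q : ℤ[X] => (Q.map (Int.castRingHom ℂ)).eval w) hid
    simpa [Polynomial.map_mul, Polynomial.map_add, Polynomial.map_pow, eval_mul, eval_add,
      eval_pow] using h
  -- a disc `ball 0 r` on which `P*` does not vanish
  have hPrc0 : Prc.eval 0 = 1 := by
    rw [← coeff_zero_eq_eval_zero, hPrc, coeff_map, coeff_zero_reverse, hmonic.leadingCoeff]; simp
  obtain ⟨r, hr0, hr1, hPr⟩ : ∃ r : ℝ, 0 < r ∧ r ≤ 1 ∧ ∀ w ∈ ball (0 : ℂ) r, Prc.eval w ≠ 0 := by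
    have hc : ContinuousAt (fun w => Prc.eval w) 0 := (Polynomial.continuous Prc).continuousAt
    have hne : ∀ᶠ w in 𝓝 (0 : ℂ), Prc.eval w ≠ 0 := by
      apply hc.eventually_ne; rw [hPrc0]; exact one_ne_zero
    obtain ⟨r, hr0, hr⟩ := Metric.eventually_nhds_iff_ball.mp hne
    exact ⟨min r 1, lt_min hr0 one_pos, min_le_right _ _,
      fun w hw => hr w (ball_subset_ball (min_le_left _ _) hw)⟩
  have hsub : ball (0 : ℂ) r ⊆ ball 0 1 := ball_subset_ball hr1
  have hgr : DifferentiableOn ℂ g (ball 0 r) := hg.mono hsub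
  have hfr : DifferentiableOn ℂ f (ball 0 r) := hf.mono hsub
  -- `h = g / P*` and `E = R h`
  set h : ℂ → ℂ := fun w => g w / Prc.eval w with hh
  have hhd : DifferentiableOn ℂ h (ball 0 r) :=
    hgr.div (Polynomial.differentiable Prc).differentiableOn hPr
  set E : ℂ → ℂ := fun w => Rc.eval w * h w with hE
  have hEd : DifferentiableOn ℂ E (ball 0 r) := (Polynomial.differentiable Rc).differentiableOn.mul hhd
  -- the pointwise identity on the small disc
  have hpt : ∀ w ∈ ball (0 : ℂ) r, f w =
      g w + (a : ℂ) * (w ^ k * g w) + (b : ℂ) * (w ^ ℓ * h w) + w ^ (ℓ + 1) * E w := by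
    intro w hw
    have h1 := hfg w (hsub hw)
    have h2 := hidC w
    have h3 := hPr w hw
    simp only [hE, hh]
    field_simp
    linear_combination h1 + g w * h2
  -- Taylor coefficients of the right-hand side
  have hd1 : DifferentiableOn ℂ (fun w => w ^ k * g w) (ball 0 r) := (differentiableOn_id.pow k).mul hgr
  have hd2 : DifferentiableOn ℂ (fun w => w ^ ℓ * h w) (ball 0 r) := (differentiableOn_id.pow ℓ).mul hhd
  have hd3 : DifferentiableOn ℂ (fun w => w ^ (ℓ + 1) * E w) (ball 0 r) :=
    (differentiableOn_id.pow (ℓ + 1)).mul hEd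
  have dA : DifferentiableOn ℂ (fun w => g w + (a : ℂ) * (w ^ k * g w)) (ball 0 r) :=
    hgr.add (hd1.const_mul _)
  have dB : DifferentiableOn ℂ (fun w => (b : ℂ) * (w ^ ℓ * h w)) (ball 0 r) := hd2.const_mul _
  have dAB : DifferentiableOn ℂ (fun w => g w + (a : ℂ) * (w ^ k * g w) + (b : ℂ) * (w ^ ℓ * h w))
      (ball 0 r) := dA.add dB
  have dABC : DifferentiableOn ℂ
      (fun w => g w + (a : ℂ) * (w ^ k * g w) + (b : ℂ) * (w ^ ℓ * h w) + w ^ (ℓ + 1) * E w)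
      (ball 0 r) := dAB.add hd3
  intro n hn
  rw [jetCoeff_congr hr0 dABC hpt n, jetCoeff_add hr0 dAB hd3, jetCoeff_add hr0 dA dB,
    jetCoeff_add hr0 hgr (hd1.const_mul _), jetCoeff_const_mul hr0 hd1, jetCoeff_const_mul hr0 hd2,
    jetCoeff_pow_mul' hr0 hgr, jetCoeff_pow_mul' hr0 hhd, jetCoeff_pow_mul' hr0 hEd,
    if_neg (by omega : ¬ ℓ + 1 ≤ n), add_zero]
  have e2 : (a : ℂ) * (if k ≤ n then jetCoeff g (n - k) else 0) =
      if k ≤ n then (a : ℂ) * jetCoeff g (n - k) else 0 := by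
    split_ifs <;> simp
  have e3 : (b : ℂ) * (if ℓ ≤ n then jetCoeff h (n - ℓ) else 0) =
      if n = ℓ then (b : ℂ) * g 0 else 0 := by
    by_cases hnl : n = ℓ
    · subst hnl
      rw [if_pos le_rfl, if_pos rfl, Nat.sub_self, jetCoeff_zero]
      simp [hh, hPrc0]
    · rw [if_neg (by omega), if_neg hnl, mul_zero]
  rw [e2, e3]

/-! ### The theorem -/

/-- Core case: `P` monic, `P(0) = ε = ±1`, `P.reverse ≠ ε P` ⟹ `M(P) ≥ θ₀`.
[cite: MckeeSmyth2021, Theorem 12.1 p.205] -/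
theorem smythTheta_le_of_monic {P : ℤ[X]} (hmonic : P.Monic) {ε : ℤ} (hε : P.coeff 0 = ε)
    (hε1 : ε * ε = 1) (hne : P.reverse ≠ C ε * P) (hM1 : 1 < intMahlerMeasure P) :
    smythTheta ≤ intMahlerMeasure P := by
  obtain ⟨k, ℓ, a, b, R, hk, hkl, ha, hb, hid⟩ := exists_second_nonpalindromic_coeff hmonic hε hε1 hne
  obtain ⟨f₀, g₀, hf₀d, hg₀d, hf₀b, hg₀b, hfg₀, hg₀0, hfg₀0, hf₀s, hg₀s⟩ :=
    exists_blaschke_data_symm hmonic hε hε1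
  set M := intMahlerMeasure P
  have hMpos : 0 < M := lt_trans one_pos hM1
  -- `g₀ 0` is real of modulus `1/M`; normalise its sign
  have hg₀real : ((g₀ 0).re : ℂ) = g₀ 0 := by
    apply Complex.conj_eq_iff_re.mp
    have := hg₀s 0
    rw [map_zero] at this
    exact this.symm
  set σ : ℝ := if 0 ≤ (g₀ 0).re then 1 else -1 with hσ
  have hσabs : |σ| = 1 := by rw [hσ]; split_ifs <;> norm_num
  set c : ℝ := σ * (g₀ 0).re with hcdef
  have hcabs : c = |(g₀ 0).re| := by
    rw [hcdef, hσ]; split_ifs with h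
    · rw [one_mul, abs_of_nonneg h]
    · push Not at h; rw [abs_of_neg h]; ring
  have hnorm : ‖g₀ 0‖ = |(g₀ 0).re| := by
    conv_lhs => rw [← hg₀real]
    rw [Complex.norm_real, Real.norm_eq_abs]
  have hcM : c = M⁻¹ := by rw [hcabs, ← hnorm, hg₀0]
  have hcpos : 0 < c := by rw [hcM]; positivity
  have hclt : c < 1 := by rw [hcM]; exact inv_lt_one_of_one_lt₀ hM1
  -- the normalised pair
  set f : ℂ → ℂ := fun z => (σ : ℂ) * f₀ z
  set g : ℂ → ℂ := fun z => (σ : ℂ) * g₀ z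
  have hfd : DifferentiableOn ℂ f (ball 0 1) := hf₀d.const_mul _
  have hgd : DifferentiableOn ℂ g (ball 0 1) := hg₀d.const_mul _
  have hσn : ‖(σ : ℂ)‖ = 1 := by rw [Complex.norm_real, Real.norm_eq_abs, hσabs]
  have hfS : IsSchurClass f := ⟨hfd, fun z hz => by
    show ‖(σ : ℂ) * f₀ z‖ ≤ 1
    rw [norm_mul, hσn, one_mul]; exact hf₀b z hz⟩
  have hgS : IsSchurClass g := ⟨hgd, fun z hz => by
    show ‖(σ : ℂ) * g₀ z‖ ≤ 1
    rw [norm_mul, hσn, one_mul]; exact hg₀b z hz⟩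
  have hfsym : ∀ z, f (conj z) = conj (f z) := fun z => by
    show (σ : ℂ) * f₀ (conj z) = conj ((σ : ℂ) * f₀ z)
    rw [map_mul, Complex.conj_ofReal, hf₀s]
  have hgsym : ∀ z, g (conj z) = conj (g z) := fun z => by
    show (σ : ℂ) * g₀ (conj z) = conj ((σ : ℂ) * g₀ z)
    rw [map_mul, Complex.conj_ofReal, hg₀s]
  have hfg : ∀ z ∈ ball (0 : ℂ) 1, f z * (P.reverse.map (Int.castRingHom ℂ)).eval z =
      (ε : ℂ) * (P.map (Int.castRingHom ℂ)).eval z * g z := by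
    intro z hz
    show (σ : ℂ) * f₀ z * _ = (ε : ℂ) * _ * ((σ : ℂ) * g₀ z)
    rw [mul_assoc, hfg₀ z hz]; ring
  have hg0 : jetCoeff g 0 = c := by
    rw [jetCoeff_zero]
    show (σ : ℂ) * g₀ 0 = ((σ * (g₀ 0).re : ℝ) : ℂ)
    conv_lhs => rw [← hg₀real]
    push_cast; ring
  have hf0 : jetCoeff f 0 = c := by
    rw [jetCoeff_zero]
    show (σ : ℂ) * f₀ 0 = ((σ * (g₀ 0).re : ℝ) : ℂ)
    rw [hfg₀0]
    conv_lhs => rw [← hg₀real]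
    push_cast; ring
  have D : SmythData f g c :=
    ⟨hfS, hgS, jetCoeff_conj_of_symm one_pos hfd hfsym, jetCoeff_conj_of_symm one_pos hgd hgsym,
      hf0, hg0, hcpos, hclt⟩
  -- the relations, real parts
  have hrelC := smyth_relations hmonic hid hfd hgd hfg
  have hg0' : g 0 = (c : ℂ) := by rw [← hg0, jetCoeff_zero]
  have hrel : ∀ n, n ≤ ℓ → (jetCoeff f n).re = (jetCoeff g n).re +
      (if k ≤ n then (a : ℝ) * (jetCoeff g (n - k)).re else 0) +
      (if n = ℓ then (b : ℝ) * c else 0) := by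
    intro n hn
    have h := congrArg Complex.re (hrelC n hn)
    rw [hg0'] at h
    rw [h, Complex.add_re, Complex.add_re]
    congr 2
    · split_ifs
      · rw [show ((a : ℤ) : ℂ) = ((a : ℝ) : ℂ) by norm_cast, Complex.re_ofReal_mul]
      · simp
    · split_ifs
      · rw [show ((b : ℤ) : ℂ) = ((b : ℝ) : ℂ) by norm_cast, Complex.re_ofReal_mul, Complex.ofReal_re]
      · simp
  have key := smyth_analytic D hk hkl ha hb hrel
  -- `c² + c³ ≤ 1` with `c = 1/M` gives `M ≥ θ₀`
  rw [hcM] at key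
  exact smythTheta_le_of_inv hMpos key

/-- **Smyth's theorem** (Smyth 1971; [McKee–Smyth, Thm 12.1]).  An integer polynomial with
`P(0) ≠ 0` which is neither reciprocal nor antireciprocal has Mahler measure `≥ θ₀ = 1.3247…`
(the real root of `t³ = t + 1`, `= M(z³ - z - 1)`).  No irreducibility is assumed.
[cite: MckeeSmyth2021, Theorem 12.1 p.205] -/
theorem intMahlerMeasure_ge_smythTheta_of_nonreciprocal {P : ℤ[X]} (h0 : P.coeff 0 ≠ 0)
    (h1 : P.reverse ≠ P) (h2 : P.reverse ≠ -P) : smythTheta ≤ intMahlerMeasure P := by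
  have hP0 : P ≠ 0 := fun h => h0 (by simp [h])
  have hθ2 : smythTheta ≤ 2 := le_trans smythTheta_lt.le (by norm_num)
  -- leading coefficient `± 1`, else `M ≥ 2`
  by_cases hlc : 2 ≤ |P.leadingCoeff|
  · have h := abs_leadingCoeff_le_intMahlerMeasure P
    have : (2 : ℝ) ≤ |(P.leadingCoeff : ℝ)| := by exact_mod_cast hlc
    linarith
  have hlc1 : |P.leadingCoeff| = 1 := by
    have hne : P.leadingCoeff ≠ 0 := leadingCoeff_ne_zero.mpr hP0
    have := Int.one_le_abs hne
    omega
  -- reduce to the monic case via `P ↦ -P`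
  obtain ⟨Q, hQm, hQM, hQ0, hQ1, hQ2⟩ : ∃ Q : ℤ[X], Q.Monic ∧ intMahlerMeasure Q = intMahlerMeasure P ∧
      Q.coeff 0 ≠ 0 ∧ Q.reverse ≠ Q ∧ Q.reverse ≠ -Q := by
    rcases (abs_eq (zero_le_one' ℤ)).mp hlc1 with h | h
    · exact ⟨P, h, rfl, h0, h1, h2⟩
    · refine ⟨-P, ?_, intMahlerMeasure_neg P, by simpa using h0, ?_, ?_⟩
      · rw [Monic, leadingCoeff_neg, h, neg_neg]
      · rw [reverse_neg]; intro h'; exact h1 (neg_injective h')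
      · rw [reverse_neg, neg_neg]; intro h'; exact h2 (by rw [← neg_neg P.reverse, h'])
  rw [← hQM]
  -- constant coefficient `± 1`, else `M ≥ 2`
  by_cases hc : 2 ≤ |Q.coeff 0|
  · have h := abs_coeff_zero_le_intMahlerMeasure hQm
    have : (2 : ℝ) ≤ |(Q.coeff 0 : ℝ)| := by exact_mod_cast hc
    linarith
  have hc1 : |Q.coeff 0| = 1 := by
    have := Int.one_le_abs hQ0
    omega
  set ε := Q.coeff 0 with hεdef
  have hε1 : ε * ε = 1 := by
    rcases (abs_eq (zero_le_one' ℤ)).mp hc1 with h | h <;> simp [h]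
  have hne : Q.reverse ≠ C ε * Q := by
    rcases (abs_eq (zero_le_one' ℤ)).mp hc1 with h | h
    · rw [h, C_1, one_mul]; exact hQ1
    · rw [h, C_neg, C_1, neg_one_mul]; exact hQ2
  -- `M(Q) > 1` (indeed `≥ 1.28` by the gen-7 bound)
  have hM1 : 1 < intMahlerMeasure Q := lt_trans (by norm_num) (intMahlerMeasure_gt_of_nonreciprocal hQ0 hQ1 hQ2)
  exact smythTheta_le_of_monic hQm rfl hε1 hne hM1

/-- Numerical form: a nonreciprocal integer polynomial with `P(0) ≠ 0` has `M(P) > 1.3247`.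
[cite: MckeeSmyth2021, Theorem 12.1 p.205] -/
theorem intMahlerMeasure_gt_13247_of_nonreciprocal {P : ℤ[X]} (h0 : P.coeff 0 ≠ 0)
    (h1 : P.reverse ≠ P) (h2 : P.reverse ≠ -P) : (13247 : ℝ) / 10000 < intMahlerMeasure P :=
  lt_of_lt_of_le smythTheta_gt (intMahlerMeasure_ge_smythTheta_of_nonreciprocal h0 h1 h2)

/-- `M(z³ - z - 1) ≤ M(P)` for every nonreciprocal `P ∈ ℤ[X]` with `P(0) ≠ 0`.
[cite: MckeeSmyth2021, Theorem 12.1 p.205] -/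
theorem mahlerMeasure_X_cube_sub_X_sub_one_le_of_nonreciprocal {P : ℤ[X]} (h0 : P.coeff 0 ≠ 0)
    (h1 : P.reverse ≠ P) (h2 : P.reverse ≠ -P) :
    ((X ^ 3 - X - 1 : ℤ[X]).map (Int.castRingHom ℂ)).mahlerMeasure ≤
      (P.map (Int.castRingHom ℂ)).mahlerMeasure := by
  rw [mahlerMeasure_map_X_cube_sub_X_sub_one]
  exact intMahlerMeasure_ge_smythTheta_of_nonreciprocal h0 h1 h2

end

end Literature.NumberTheory.MahlerMeasure

end Part7

/-!
## Part 8 — port of `Summits/Ventures/DiscreteObjects/Mahler/MahlerMeasureCompXPow.lean` (4 declarations kept)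

SHARPNESS of Smyth's bound (the equality clause of McKee–Smyth Theorem 12.1, existence half): `M(x^{3k} − x^k − 1) = θ₀` for every `k ≥ 1` (through `M(p(x^k)) = M(p)` of `IntegerMahlerMeasure.lean`), `x³ − x − 1` is nonreciprocal with nonzero constant term, hence `θ₀` is attained and is the LEAST Mahler measure of a nonreciprocal integer polynomial with nonzero constant term (`isLeast_smythTheta`).  (The generic lemmas of this source module are in `IntegerMahlerMeasure.lean`.)
-/

section Part8

namespace Literature.NumberTheory.MahlerMeasure

open Literature.Analysis.Complex Literature.Analysis.Complex.SchurAlgorithm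

open _root_.Polynomial

/-- `M(x^{3k} - x^k - 1) = θ₀` for every `k ≥ 1`.
[cite: MckeeSmyth2021, Theorem 12.1 p.205 (equality clause: z^{3n} − z^n − 1)] -/
theorem intMahlerMeasure_X_pow_three_mul_sub {k : ℕ} (hk : 1 ≤ k) :
    intMahlerMeasure (X ^ (3 * k) - X ^ k - 1 : ℤ[X]) = smythTheta := by
  have h : (X ^ (3 * k) - X ^ k - 1 : ℤ[X]) = (X ^ 3 - X - 1 : ℤ[X]).comp (X ^ k) := by
    simp only [sub_comp, pow_comp, X_comp, one_comp]
    rw [← pow_mul, mul_comm]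
  rw [h, intMahlerMeasure_comp_X_pow _ hk, intMahlerMeasure_X_cube_sub_X_sub_one]

/-- `x³ - x - 1` is neither reciprocal nor antireciprocal and has nonzero constant term.
[cite: MckeeSmyth2021, Theorem 12.1 p.205 (equality clause: z^{3n} − z^n − 1)] -/
theorem X_cube_sub_X_sub_one_nonreciprocal :
    (X ^ 3 - X - 1 : ℤ[X]).coeff 0 ≠ 0 ∧ (X ^ 3 - X - 1 : ℤ[X]).reverse ≠ (X ^ 3 - X - 1) ∧
      (X ^ 3 - X - 1 : ℤ[X]).reverse ≠ -(X ^ 3 - X - 1) := by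
  have hdeg : (X ^ 3 - X - 1 : ℤ[X]).natDegree = 3 := by compute_degree!
  have hc1 : (X ^ 3 - X - 1 : ℤ[X]).reverse.coeff 1 = 0 := by
    rw [coeff_reverse, hdeg, revAt_le (by norm_num)]
    simp [coeff_X, coeff_one]
  have hp1 : (X ^ 3 - X - 1 : ℤ[X]).coeff 1 = -1 := by simp [coeff_X, coeff_one]
  refine ⟨by simp, ?_, ?_⟩
  · intro h
    have h' : (X ^ 3 - X - 1 : ℤ[X]).reverse.coeff 1 = (X ^ 3 - X - 1 : ℤ[X]).coeff 1 := by rw [h]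
    rw [hc1, hp1] at h'
    norm_num at h'
  · intro h
    have h' : (X ^ 3 - X - 1 : ℤ[X]).reverse.coeff 1 = (-(X ^ 3 - X - 1 : ℤ[X])).coeff 1 := by
      rw [h]
    rw [coeff_neg, hc1, hp1] at h'
    norm_num at h'

/-- **Smyth's bound is attained**: there is a nonreciprocal integer polynomial with nonzero
constant term and Mahler measure exactly `θ₀` (namely `x³ - x - 1`).
[cite: MckeeSmyth2021, Theorem 12.1 p.205 (equality clause: z^{3n} − z^n − 1)] -/
theorem smyth_bound_attained :
    ∃ P : ℤ[X], P.coeff 0 ≠ 0 ∧ P.reverse ≠ P ∧ P.reverse ≠ -P ∧ intMahlerMeasure P = smythTheta :=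
  ⟨X ^ 3 - X - 1, X_cube_sub_X_sub_one_nonreciprocal.1, X_cube_sub_X_sub_one_nonreciprocal.2.1,
    X_cube_sub_X_sub_one_nonreciprocal.2.2, intMahlerMeasure_X_cube_sub_X_sub_one⟩

/-- The infimum form: `θ₀` is the least Mahler measure of a nonreciprocal integer polynomial with
nonzero constant term. [cite: MckeeSmyth2021, Theorem 12.1 p.205 (equality clause: z^{3n} − z^n − 1)] -/
theorem isLeast_smythTheta :
    IsLeast {m : ℝ | ∃ P : ℤ[X], P.coeff 0 ≠ 0 ∧ P.reverse ≠ P ∧ P.reverse ≠ -P ∧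
      intMahlerMeasure P = m} smythTheta := by
  refine ⟨?_, ?_⟩
  · obtain ⟨P, h0, h1, h2, hM⟩ := smyth_bound_attained
    exact ⟨P, h0, h1, h2, hM⟩
  · rintro m ⟨P, h0, h1, h2, rfl⟩
    exact intMahlerMeasure_ge_smythTheta_of_nonreciprocal h0 h1 h2

end Literature.NumberTheory.MahlerMeasure

end Part8

/-! ## Part 9 — the EXACT discharge(s) -/

namespace Literature.NumberTheory.MahlerMeasure

/-- **The Literature named fact `NonreciprocalMahlerBound` HOLDS** — Smyth's theorem [McKee–Smyth, Theorem 12.1]: an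
irreducible `P ∈ ℤ[X]` with `P(0) ≠ 0`, `P.reverse ≠ ± P`, has `M(z³ − z − 1) ≤ M(P)` (irreducibility is not used).
EXACT discharge, Literature-side twin of `Summit.Ventures.DiscreteObjects.Mahler.nonreciprocalMahlerBound_holds`.
[cite: MckeeSmyth2021, Theorem 12.1 p.205] -/
theorem NonreciprocalMahlerBound_holds : NonreciprocalMahlerBound :=
  fun _ _ h0 h1 h2 => mahlerMeasure_X_cube_sub_X_sub_one_le_of_nonreciprocal h0 h1 h2

end Literature.NumberTheory.MahlerMeasure

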